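import Literature.Probability.LatticeModels.UrsellClusterExpansion
import Literature.Probability.LatticeModels.UrsellMonotonicityClones
import Literature.Probability.LatticeModels.UrsellExplicitFormula
import Mathlib.Data.Nat.Choose.Sum
import Mathlib.Analysis.Calculus.Deriv.MeanValue
import HarnessLib

/-!
# Camia–Jiang–Newman 2023, Theorem 1, for all orders — the proof file of `CamiaJiangNewman2023_thm1`

Topic `Literature/Probability/LatticeModels`; continues `UrsellClusterExpansion` and closes the named fact
`CamiaJiangNewman2023_thm1` of `UrsellMonotonicity.lean` (`CamiaJiangNewman2023_thm1_holds`, at the end), together with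
Shlosman's sign theorem for all orders (`PairIsing.ursell_sign`).  The file is organised in four parts, each with its own
header below:

1. **the pair-derivative family identities** (`Current.familyC1`, `familyC2a`, `familyC2b`) — the cluster expansions of
   `D_{ab}(U') 𝟙[U=∅]` and of `u(U+a) u(U'+b)` rooted at `a` and at `b`;
2. **the sign recursion** `Current.masterB`: `(2m-1) u(W) = Σ_x Σ_A cw_A({w₀,x}) e_A^{(2)}(…)`;
3. **the derivative master identity** `Current.masterC`: `2m D_{ab}(X) = Σ_x Σ_A (cw ν² + cw ν²)`;
4. **the joint induction on the order**: CJN eq. (20) as `∂u/∂J_{ab} = D_{ab}`, the block signs from the lower orders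
   (Shlosman's sign for blocks meeting the cluster, monotonicity in the couplings otherwise), `masterB ⇒` signs,
   `masterC ⇒` derivative signs, the clone reduction, and the fact.

The published arguments are not followed: the induction of Camia–Jiang–Newman §3 rests on their Prop. 2 / eq. (31), which is
false as printed (`UrsellMonotonicityGraphPartitions`), and the induction hypothesis of Shlosman's Thm 3 fails at order 6;
the two exact identities `masterB`, `masterC` of the random-current cluster calculus (`TwoCurrentClusterCalculus`,
`UrsellClusterExpansion`) replace them.  Nothing in this file is a named fact.

## References

* F. Camia, J. Jiang, C. M. Newman, *Monotonicity of Ursell functions in the Ising model*, Comm. Math. Phys. 401 (2023)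
  2459–2482, arXiv:2207.12247, Theorem 1, eq. (20) [CamiaJiangNewman2023].
* S. B. Shlosman, *Signs of the Ising model Ursell functions*, Comm. Math. Phys. 102 (1986) 679–686 [Shlosman1986].
* M. Aizenman, Comm. Math. Phys. 86 (1982) 1–48, §5 [AizenmanCMP1982]; R. Panis, arXiv:2309.05797, Lemma 4.4 [Panis2023Triviality].
-/


/-!
# Part 1 — the pair-derivative family identities

Continues `UrsellClusterExpansion`.  With the notation there
(`u = uK K`, `u_A = uK (cutCoupling K A)`, `e_A = eA K A 1`, `cw`), two marked vertices `a ≠ b` and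

* `Dab K a b Y = u(Y + a + b) + Σ_{S ⊆ Y} u(S + a) u((Y ∖ S) + b)` — the algebraic form of `∂u(Y+a+b)/∂J_{ab}`
  (Camia–Jiang–Newman 2023, eq. (20));
* `nuA K A b = (R ↦ u_A(R + b)) ⋆ e_A` — the weight of the `b`-block of the cut model followed by `e_A`,

we prove the three **pair family identities** (evidence "full_proof.md", Thm A' with `(P,Q) = (∅,{a,b})` rooted at
`a`, and `(P,Q) = ({a},{b})` rooted at `a` and at `b`): `Current.familyC1`, `Current.familyC2a`, `Current.familyC2b`.
As for `Current.familyA`, both sides of each identity have the same double moment transform — computed on the left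
by the block recursion at `a` and `b`, on the right by `Current.transform_atoms` + support collapse — and (†')
(`Current.corr_mul_corr_eq_sum_cw`) identifies them.  Their affine diagonal collapse is the master identity for
`∂u/∂J_{ab}` (Part 3).

## References

* F. Camia, J. Jiang, C. M. Newman, Comm. Math. Phys. 401 (2023), arXiv:2207.12247, eq. (20) [CamiaJiangNewman2023];
  M. Aizenman, Comm. Math. Phys. 86 (1982), §5 [AizenmanCMP1982]; S. B. Shlosman, Comm. Math. Phys. 102 (1986) [Shlosman1986].
-/

noncomputable section

open Finset Filter
open scoped symmDiff ENNReal

namespace Literature.Probability.LatticeModels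

/-! ### Generic: the double moment transform of a two-variable series -/

section Generic

variable {α : Type*} [DecidableEq α] {C : Type*} [CommRing C]

/-- Unfolding `⋆` at chosen arguments. [folklore] -/
theorem spConv_apply (f g : Finset α → C) (Y : Finset α) : spConv f g Y = ∑ Z ∈ Y.powerset, f Z * g (Y \ Z) := rfl

/-- `⋆` only sees the second factor on subsets. [folklore] -/
theorem spConv_congr_right (f : Finset α → C) {g g' : Finset α → C} {Y : Finset α}
    (h : ∀ Z ⊆ Y, g Z = g' Z) : spConv f g Y = spConv f g' Y :=
  sum_congr rfl fun Z _ => by rw [h (Y \ Z) sdiff_subset]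

/-- The double transform `T_M F (Z, Z') = ((F ⋆₂ M) ⋆₁ M)(Z, Z')` of a two-variable series. [folklore] -/
def transform₂ (F : Finset α → Finset α → C) (M : Finset α → C) (Z Z' : Finset α) : C :=
  spConv (fun Y => spConv (F Y) M Z') M Z

/-- Additivity of the double transform. [folklore] -/
theorem transform₂_add (F F' : Finset α → Finset α → C) (M : Finset α → C) (Z Z' : Finset α) :
    transform₂ (F + F') M Z Z' = transform₂ F M Z Z' + transform₂ F' M Z Z' := by
  unfold transform₂
  rw [← spConv_add_left]
  congr 1
  funext Y
  rw [Pi.add_apply, Pi.add_apply, spConv_add_left]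

/-- The double transform of a finite sum. [folklore] -/
theorem transform₂_sum {ι : Type*} (s : Finset ι) (F : ι → Finset α → Finset α → C) (M : Finset α → C)
    (Z Z' : Finset α) : transform₂ (∑ i ∈ s, F i) M Z Z' = ∑ i ∈ s, transform₂ (F i) M Z Z' := by
  unfold transform₂
  rw [← spConv_sum_left]
  congr 1
  funext Y
  rw [Finset.sum_apply, ← spConv_sum_left]
  congr 1
  funext Y'
  rw [Finset.sum_apply]

/-- **The double transform of a sum of atoms** `Σ_{S ⊆ Y, E ⊆ Y'} φ(S,E) ψ₁(Y∖S) ψ₂(Y'∖E)`: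
each side factor is transformed separately. [folklore] -/
theorem transform_atoms (φ : Finset α → Finset α → C) (ψ₁ ψ₂ M : Finset α → C) (Z Z' : Finset α) :
    transform₂ (fun Y Y' => ∑ S ∈ Y.powerset, ∑ E ∈ Y'.powerset, φ S E * ψ₁ (Y \ S) * ψ₂ (Y' \ E)) M Z Z' =
      ∑ S ∈ Z.powerset, ∑ E ∈ Z'.powerset, φ S E * spConv ψ₁ M (Z \ S) * spConv ψ₂ M (Z' \ E) := by
  unfold transform₂
  have inner : ∀ Y, spConv (fun Y' => ∑ S ∈ Y.powerset, ∑ E ∈ Y'.powerset, φ S E * ψ₁ (Y \ S) * ψ₂ (Y' \ E)) M Z' =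
      ∑ S ∈ Y.powerset, (∑ E ∈ Z'.powerset, φ S E * spConv ψ₂ M (Z' \ E)) * ψ₁ (Y \ S) := by
    intro Y
    have h1 : (fun Y' => ∑ S ∈ Y.powerset, ∑ E ∈ Y'.powerset, φ S E * ψ₁ (Y \ S) * ψ₂ (Y' \ E)) =
        fun Y' => ∑ S ∈ Y.powerset, spConv (fun E => φ S E * ψ₁ (Y \ S)) ψ₂ Y' := rfl
    rw [h1, spConv_sum_left]
    refine sum_congr rfl fun S _ => ?_
    rw [spConv_assoc, spConv_apply, sum_mul]
    exact sum_congr rfl fun E _ => by ring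
  simp only [inner]
  have h2 : (fun Y => ∑ S ∈ Y.powerset, (∑ E ∈ Z'.powerset, φ S E * spConv ψ₂ M (Z' \ E)) * ψ₁ (Y \ S)) =
      spConv (fun S => ∑ E ∈ Z'.powerset, φ S E * spConv ψ₂ M (Z' \ E)) ψ₁ := rfl
  rw [h2, spConv_assoc, spConv_apply]
  refine sum_congr rfl fun S _ => ?_
  rw [sum_mul]
  exact sum_congr rfl fun E _ => by ring

/-- **Double support collapse**: `φ` lives on pairs of subsets of `A`, `g₁, g₂` on sets avoiding `A`. [folklore] -/
theorem sum_powerset₂_collapse (A : Finset α) {φ : Finset α → Finset α → C} {g₁ g₂ : Finset α → C} {Z Z' : Finset α}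
    (hφ₁ : ∀ S E, ¬ S ⊆ A → φ S E = 0) (hφ₂ : ∀ S E, ¬ E ⊆ A → φ S E = 0)
    (hg₁ : ∀ R, ¬ Disjoint R A → g₁ R = 0) (hg₂ : ∀ R, ¬ Disjoint R A → g₂ R = 0) :
    ∑ S ∈ Z.powerset, ∑ E ∈ Z'.powerset, φ S E * g₁ (Z \ S) * g₂ (Z' \ E) =
      φ (Z.filter (· ∈ A)) (Z'.filter (· ∈ A)) * g₁ (Z.filter (· ∉ A)) * g₂ (Z'.filter (· ∉ A)) := by
  have hE : ∀ S ∈ Z.powerset, ∑ E ∈ Z'.powerset, φ S E * g₁ (Z \ S) * g₂ (Z' \ E) =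
      (φ S (Z'.filter (· ∈ A)) * g₂ (Z'.filter (· ∉ A))) * g₁ (Z \ S) := by
    intro S _
    have h := sum_powerset_mul_eq_filter A (f := fun E => φ S E * g₁ (Z \ S)) (g := g₂) (Z := Z')
      (fun E _ hE => by simp only [hφ₂ S E hE, zero_mul]) (fun R _ hR => hg₂ R hR)
    refine h.trans ?_
    ring
  rw [sum_congr rfl hE, sum_powerset_mul_eq_filter A (f := fun S => φ S (Z'.filter (· ∈ A)) * g₂ (Z'.filter (· ∉ A)))
    (g := g₁) (fun S _ hS => by simp only [hφ₁ S _ hS, zero_mul]) (fun R _ hR => hg₁ R hR)]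
  ring

end Generic

variable {V : Type*} [Fintype V] [DecidableEq V] {G : SimpleGraph V} [DecidableRel G.Adj]

namespace Current

variable {K : G.edgeFinset → ℝ}

/-! ### The pair-derivative form and the `b`-block weight -/

/-- `D_{ab}(Y) = u(Y+a+b) + Σ_{S ⊆ Y} u(S+a) u((Y∖S)+b)` (the right-hand side of CJN eq. (20) for the sites `Y`).
[cite: CamiaJiangNewman2023, §2 eq. (20)] -/
def Dab (K : G.edgeFinset → ℝ) (a b : V) (Y : Finset V) : ℝ :=
  uK K (insert a (insert b Y)) + ∑ S ∈ Y.powerset, uK K (insert a S) * uK K (insert b (Y \ S))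

/-- `ν_{A,b} = (R ↦ u_A(R + b)) ⋆ e_A`: the `b`-block of the cut model followed by `e_A`. [cite: Shlosman1986, §2] -/
def nuA (K : G.edgeFinset → ℝ) (A : Finset V) (b : V) : Finset V → ℝ :=
  spConv (fun R => uK (cutCoupling K A) (insert b R)) (eA K A 1)

/-- `ν_{A,b} ⋆ ⟨σ⟩ = ⟨σ_{·+b}⟩_A` on sets not containing `b`. [folklore] -/
theorem spConv_nuA_corrK (hK : ∀ e, 0 ≤ K e) (A : Finset V) {b : V} {R : Finset V} (hb : b ∉ R) :
    spConv (nuA K A b) (corrK K) R = corrK (cutCoupling K A) (insert b R) := by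
  have hfun : spConv (eA K A 1) (corrK K) = corrK (cutCoupling K A) := funext fun R => spConv_eA_corrK hK A R
  rw [nuA, spConv_assoc, hfun, spConv_apply]
  exact sum_powerset_uK_insert_mul (cutCoupling_nonneg hK A) hb

/-! ### Transforms of the left-hand sides -/

/-- `D_{ab} ⋆ ⟨σ⟩ = ⟨σ_{·+a+b}⟩`: the block recursion at `a`, then at `b`. [cite: CamiaJiangNewman2023, §2 eq. (20)] -/
theorem spConv_Dab_corrK (hK : ∀ e, 0 ≤ K e) {a b : V} (hab : a ≠ b) {Z' : Finset V} (ha : a ∉ Z') (hb : b ∉ Z') :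
    spConv (Dab K a b) (corrK K) Z' = corrK K (insert a (insert b Z')) := by
  have hsplit : Dab K a b = (fun Y => uK K (insert a (insert b Y))) +
      spConv (fun S => uK K (insert a S)) (fun R => uK K (insert b R)) := by
    funext Y; rfl
  rw [hsplit, spConv_add_left, spConv_assoc]
  -- the second convolution: block recursion at `b` inside
  have h2 : spConv (fun S => uK K (insert a S)) (spConv (fun R => uK K (insert b R)) (corrK K)) Z' =
      ∑ S ∈ Z'.powerset, uK K (insert a S) * corrK K (insert b (Z' \ S)) := by
    rw [spConv_apply]
    refine sum_congr rfl fun S hS => ?_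
    rw [spConv_apply, sum_powerset_uK_insert_mul hK (fun h => hb (sdiff_subset h))]
  rw [h2, spConv_apply]
  -- the block recursion at `a` for `insert b Z'`, split according to `b ∈ T`
  have ha' : a ∉ insert b Z' := fun h => (mem_insert.1 h).elim hab ha
  rw [← sum_powerset_uK_insert_mul hK ha', sum_powerset_insert hb, add_comm]
  refine congr_arg₂ (· + ·) (sum_congr rfl fun S hS => ?_) (sum_congr rfl fun S hS => ?_)
  · have hbS : b ∉ S := fun h => hb (mem_powerset.1 hS h)
    rw [insert_sdiff_of_notMem _ hbS]
  · rw [insert_sdiff_insert, sdiff_insert_of_notMem hb]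

/-- Transform of `𝟙[Y = ∅] D_{ab}(Y')`: `⟨σ_Z⟩ ⟨σ_{Z'+a+b}⟩`. [folklore] -/
theorem transform_C1Lhs (hK : ∀ e, 0 ≤ K e) {a b : V} (hab : a ≠ b) (Z : Finset V) {Z' : Finset V} (ha : a ∉ Z')
    (hb : b ∉ Z') :
    transform₂ (fun Y Y' => if Y = ∅ then Dab K a b Y' else 0) (corrK K) Z Z' =
      corrK K Z * corrK K (insert a (insert b Z')) := by
  unfold transform₂
  have inner : ∀ Y : Finset V, spConv (fun Y' => if Y = ∅ then Dab K a b Y' else 0) (corrK K) Z' =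
      corrK K (insert a (insert b Z')) * spOne Y := by
    intro Y
    have h : (fun Y' => if Y = ∅ then Dab K a b Y' else 0) = fun Y' => spOne Y * Dab K a b Y' := by
      funext Y'; unfold spOne; split_ifs <;> simp
    rw [h, spConv_smul_left, spConv_Dab_corrK hK hab ha hb, mul_comm]
  simp only [inner]
  rw [spConv_smul_left, spConv_spOne_left, mul_comm]

/-- Transform of `u(Y+a) u(Y'+b)`: `⟨σ_{Z+a}⟩ ⟨σ_{Z'+b}⟩`. [folklore] -/
theorem transform_C2Lhs (hK : ∀ e, 0 ≤ K e) {a b : V} {Z Z' : Finset V} (ha : a ∉ Z) (hb : b ∉ Z') :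
    transform₂ (fun Y Y' => uK K (insert a Y) * uK K (insert b Y')) (corrK K) Z Z' =
      corrK K (insert a Z) * corrK K (insert b Z') := by
  unfold transform₂
  have inner : ∀ Y : Finset V, spConv (fun Y' => uK K (insert a Y) * uK K (insert b Y')) (corrK K) Z' =
      corrK K (insert b Z') * uK K (insert a Y) := by
    intro Y
    rw [spConv_smul_left, spConv_apply, sum_powerset_uK_insert_mul hK hb, mul_comm]
  simp only [inner]
  rw [spConv_smul_left, spConv_apply, sum_powerset_uK_insert_mul hK ha, mul_comm]

/-! ### The three pair families: right-hand sides -/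

/-- Atoms of `(P,Q) = (∅,{a,b})` rooted at `a`, case `b ∈ A`: sources `S ∪ E ∪ {a,b}`, `#E` even. [cite: Shlosman1986, §2] -/
def atomC1e (K : G.edgeFinset → ℝ) (a b : V) (A : Finset V) : Finset V → Finset V → ℝ := fun U U' =>
  ∑ S ∈ U.powerset, ∑ E ∈ U'.powerset,
    (if Even #E then cw K a A (insert a (insert b (S ∪ E))) else 0) * eA K A 1 (U \ S) * eA K A 1 (U' \ E)

/-- Atoms of `(P,Q) = (∅,{a,b})` rooted at `a`, case `b ∉ A`: sources `S ∪ E ∪ {a}`, `#E` odd, `b`-block. [cite: Shlosman1986, §2] -/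
def atomC1o (K : G.edgeFinset → ℝ) (a b : V) (A : Finset V) : Finset V → Finset V → ℝ := fun U U' =>
  ∑ S ∈ U.powerset, ∑ E ∈ U'.powerset,
    (if Even #E then 0 else cw K a A (insert a (S ∪ E))) * eA K A 1 (U \ S) * nuA K A b (U' \ E)

/-- The right-hand side of the first pair family identity. [cite: Shlosman1986, §2] -/
def famC1Rhs (K : G.edgeFinset → ℝ) (a b : V) : Finset V → Finset V → ℝ :=
  ∑ A : Finset V, (atomC1e K a b A + atomC1o K a b A)

/-- Atoms of `(P,Q) = ({a},{b})` rooted at `a`, case `b ∈ A`: `#E` odd. [cite: Shlosman1986, §2] -/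
def atomC2ao (K : G.edgeFinset → ℝ) (a b : V) (A : Finset V) : Finset V → Finset V → ℝ := fun U U' =>
  ∑ S ∈ U.powerset, ∑ E ∈ U'.powerset,
    (if Even #E then 0 else cw K a A (insert a (insert b (S ∪ E)))) * eA K A 1 (U \ S) * eA K A 1 (U' \ E)

/-- Atoms of `(P,Q) = ({a},{b})` rooted at `a`, case `b ∉ A`: `#E` even, `b`-block. [cite: Shlosman1986, §2] -/
def atomC2ae (K : G.edgeFinset → ℝ) (a b : V) (A : Finset V) : Finset V → Finset V → ℝ := fun U U' =>
  ∑ S ∈ U.powerset, ∑ E ∈ U'.powerset,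
    (if Even #E then cw K a A (insert a (S ∪ E)) else 0) * eA K A 1 (U \ S) * nuA K A b (U' \ E)

/-- The right-hand side of the second pair family identity (root `a`). [cite: Shlosman1986, §2] -/
def famC2aRhs (K : G.edgeFinset → ℝ) (a b : V) : Finset V → Finset V → ℝ :=
  ∑ A : Finset V, (atomC2ao K a b A + atomC2ae K a b A)

/-- Atoms of `(P,Q) = ({a},{b})` rooted at `b`, case `a ∈ A`: `#E` odd. [cite: Shlosman1986, §2] -/
def atomC2bo (K : G.edgeFinset → ℝ) (a b : V) (A : Finset V) : Finset V → Finset V → ℝ := fun U U' =>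
  ∑ S ∈ U.powerset, ∑ E ∈ U'.powerset,
    (if Even #E then 0 else cw K b A (insert a (insert b (S ∪ E)))) * eA K A 1 (U \ S) * eA K A 1 (U' \ E)

/-- Atoms of `(P,Q) = ({a},{b})` rooted at `b`, case `a ∉ A`: `#E` odd, `a`-block. [cite: Shlosman1986, §2] -/
def atomC2ba (K : G.edgeFinset → ℝ) (a b : V) (A : Finset V) : Finset V → Finset V → ℝ := fun U U' =>
  ∑ S ∈ U.powerset, ∑ E ∈ U'.powerset,
    (if Even #E then 0 else cw K b A (insert b (S ∪ E))) * nuA K A a (U \ S) * eA K A 1 (U' \ E)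

/-- The right-hand side of the third pair family identity (root `b`). [cite: Shlosman1986, §2] -/
def famC2bRhs (K : G.edgeFinset → ℝ) (a b : V) : Finset V → Finset V → ℝ :=
  ∑ A : Finset V, (atomC2bo K a b A + atomC2ba K a b A)

/-! ### Transforms of the atoms -/

section Transforms

variable (hK : ∀ e, 0 ≤ K e)
include hK

/-- `e_A ⋆ ⟨σ⟩ = ⟨σ⟩_A` as an identity of functions. [folklore] -/
private theorem hfun (A : Finset V) : spConv (eA K A 1) (corrK K) = corrK (cutCoupling K A) :=
  funext fun R => spConv_eA_corrK hK A R

/-- Transform of the atoms `atomC1e`. [cite: AizenmanCMP1982, §5 (conditioning on clusters)] -/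
theorem transform_atomC1e (a b : V) (A Z Z' : Finset V) :
    transform₂ (atomC1e K a b A) (corrK K) Z Z' =
      (if Even #(Z'.filter (· ∈ A)) then cw K a A (insert a (insert b (Z.filter (· ∈ A) ∪ Z'.filter (· ∈ A)))) else 0) *
        corrK (cutCoupling K A) (Z.filter (· ∉ A)) * corrK (cutCoupling K A) (Z'.filter (· ∉ A)) := by
  unfold atomC1e
  rw [transform_atoms, hfun hK]
  refine sum_powerset₂_collapse A (fun S E hS => ?_) (fun S E hE => ?_)
    (fun R hR => corrK_cutCoupling_eq_zero K hR) (fun R hR => corrK_cutCoupling_eq_zero K hR)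
  · have : ¬ insert a (insert b (S ∪ E)) ⊆ A := fun h => hS fun x hx =>
      h (mem_insert_of_mem (mem_insert_of_mem (mem_union_left _ hx)))
    simp only [cw_eq_zero_of_not_subset K a this, ite_self]
  · have : ¬ insert a (insert b (S ∪ E)) ⊆ A := fun h => hE fun x hx =>
      h (mem_insert_of_mem (mem_insert_of_mem (mem_union_right _ hx)))
    simp only [cw_eq_zero_of_not_subset K a this, ite_self]

/-- Transform of the atoms `atomC1o`. [cite: AizenmanCMP1982, §5 (conditioning on clusters)] -/
theorem transform_atomC1o (a b : V) (A Z : Finset V) {Z' : Finset V} (hb : b ∉ Z') :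
    transform₂ (atomC1o K a b A) (corrK K) Z Z' =
      (if Even #(Z'.filter (· ∈ A)) then 0 else cw K a A (insert a (Z.filter (· ∈ A) ∪ Z'.filter (· ∈ A)))) *
        corrK (cutCoupling K A) (Z.filter (· ∉ A)) * corrK (cutCoupling K A) (insert b (Z'.filter (· ∉ A))) := by
  unfold atomC1o
  rw [transform_atoms, hfun hK]
  -- replace `ν ⋆ M` by `⟨σ_{·+b}⟩_A` on the subsets of `Z'`
  have hν : ∀ S ∈ Z.powerset, ∀ E ∈ Z'.powerset,
      (if Even #E then 0 else cw K a A (insert a (S ∪ E))) * corrK (cutCoupling K A) (Z \ S) *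
        spConv (nuA K A b) (corrK K) (Z' \ E) =
      (if Even #E then 0 else cw K a A (insert a (S ∪ E))) * corrK (cutCoupling K A) (Z \ S) *
        corrK (cutCoupling K A) (insert b (Z' \ E)) := by
    intro S _ E _
    rw [spConv_nuA_corrK hK A (fun h => hb (sdiff_subset h))]
  rw [sum_congr rfl fun S hS => sum_congr rfl fun E hE => hν S hS E hE]
  refine sum_powerset₂_collapse A (g₂ := fun R => corrK (cutCoupling K A) (insert b R))
    (fun S E hS => ?_) (fun S E hE => ?_)
    (fun R hR => corrK_cutCoupling_eq_zero K hR) (fun R hR => corrK_cutCoupling_eq_zero K ?_)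
  · have : ¬ insert a (S ∪ E) ⊆ A := fun h => hS fun x hx => h (mem_insert_of_mem (mem_union_left _ hx))
    simp only [cw_eq_zero_of_not_subset K a this, ite_self]
  · have : ¬ insert a (S ∪ E) ⊆ A := fun h => hE fun x hx => h (mem_insert_of_mem (mem_union_right _ hx))
    simp only [cw_eq_zero_of_not_subset K a this, ite_self]
  · exact fun h => hR (disjoint_of_subset_left (subset_insert b R) h)

/-- Transform of the atoms `atomC2ao`. [cite: AizenmanCMP1982, §5 (conditioning on clusters)] -/
theorem transform_atomC2ao (a b : V) (A Z Z' : Finset V) :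
    transform₂ (atomC2ao K a b A) (corrK K) Z Z' =
      (if Even #(Z'.filter (· ∈ A)) then 0 else cw K a A (insert a (insert b (Z.filter (· ∈ A) ∪ Z'.filter (· ∈ A))))) *
        corrK (cutCoupling K A) (Z.filter (· ∉ A)) * corrK (cutCoupling K A) (Z'.filter (· ∉ A)) := by
  unfold atomC2ao
  rw [transform_atoms, hfun hK]
  refine sum_powerset₂_collapse A (fun S E hS => ?_) (fun S E hE => ?_)
    (fun R hR => corrK_cutCoupling_eq_zero K hR) (fun R hR => corrK_cutCoupling_eq_zero K hR)
  · have : ¬ insert a (insert b (S ∪ E)) ⊆ A := fun h => hS fun x hx =>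
      h (mem_insert_of_mem (mem_insert_of_mem (mem_union_left _ hx)))
    simp only [cw_eq_zero_of_not_subset K a this, ite_self]
  · have : ¬ insert a (insert b (S ∪ E)) ⊆ A := fun h => hE fun x hx =>
      h (mem_insert_of_mem (mem_insert_of_mem (mem_union_right _ hx)))
    simp only [cw_eq_zero_of_not_subset K a this, ite_self]

/-- Transform of the atoms `atomC2ae`. [cite: AizenmanCMP1982, §5 (conditioning on clusters)] -/
theorem transform_atomC2ae (a b : V) (A Z : Finset V) {Z' : Finset V} (hb : b ∉ Z') :
    transform₂ (atomC2ae K a b A) (corrK K) Z Z' =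
      (if Even #(Z'.filter (· ∈ A)) then cw K a A (insert a (Z.filter (· ∈ A) ∪ Z'.filter (· ∈ A))) else 0) *
        corrK (cutCoupling K A) (Z.filter (· ∉ A)) * corrK (cutCoupling K A) (insert b (Z'.filter (· ∉ A))) := by
  unfold atomC2ae
  rw [transform_atoms, hfun hK]
  have hν : ∀ S ∈ Z.powerset, ∀ E ∈ Z'.powerset,
      (if Even #E then cw K a A (insert a (S ∪ E)) else 0) * corrK (cutCoupling K A) (Z \ S) *
        spConv (nuA K A b) (corrK K) (Z' \ E) =
      (if Even #E then cw K a A (insert a (S ∪ E)) else 0) * corrK (cutCoupling K A) (Z \ S) *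
        corrK (cutCoupling K A) (insert b (Z' \ E)) := by
    intro S _ E _
    rw [spConv_nuA_corrK hK A (fun h => hb (sdiff_subset h))]
  rw [sum_congr rfl fun S hS => sum_congr rfl fun E hE => hν S hS E hE]
  refine sum_powerset₂_collapse A (g₂ := fun R => corrK (cutCoupling K A) (insert b R))
    (fun S E hS => ?_) (fun S E hE => ?_)
    (fun R hR => corrK_cutCoupling_eq_zero K hR) (fun R hR => corrK_cutCoupling_eq_zero K ?_)
  · have : ¬ insert a (S ∪ E) ⊆ A := fun h => hS fun x hx => h (mem_insert_of_mem (mem_union_left _ hx))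
    simp only [cw_eq_zero_of_not_subset K a this, ite_self]
  · have : ¬ insert a (S ∪ E) ⊆ A := fun h => hE fun x hx => h (mem_insert_of_mem (mem_union_right _ hx))
    simp only [cw_eq_zero_of_not_subset K a this, ite_self]
  · exact fun h => hR (disjoint_of_subset_left (subset_insert b R) h)

/-- Transform of the atoms `atomC2bo`. [cite: AizenmanCMP1982, §5 (conditioning on clusters)] -/
theorem transform_atomC2bo (a b : V) (A Z Z' : Finset V) :
    transform₂ (atomC2bo K a b A) (corrK K) Z Z' =
      (if Even #(Z'.filter (· ∈ A)) then 0 else cw K b A (insert a (insert b (Z.filter (· ∈ A) ∪ Z'.filter (· ∈ A))))) *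
        corrK (cutCoupling K A) (Z.filter (· ∉ A)) * corrK (cutCoupling K A) (Z'.filter (· ∉ A)) := by
  unfold atomC2bo
  rw [transform_atoms, hfun hK]
  refine sum_powerset₂_collapse A (fun S E hS => ?_) (fun S E hE => ?_)
    (fun R hR => corrK_cutCoupling_eq_zero K hR) (fun R hR => corrK_cutCoupling_eq_zero K hR)
  · have : ¬ insert a (insert b (S ∪ E)) ⊆ A := fun h => hS fun x hx =>
      h (mem_insert_of_mem (mem_insert_of_mem (mem_union_left _ hx)))
    simp only [cw_eq_zero_of_not_subset K b this, ite_self]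
  · have : ¬ insert a (insert b (S ∪ E)) ⊆ A := fun h => hE fun x hx =>
      h (mem_insert_of_mem (mem_insert_of_mem (mem_union_right _ hx)))
    simp only [cw_eq_zero_of_not_subset K b this, ite_self]

/-- Transform of the atoms `atomC2ba`. [cite: AizenmanCMP1982, §5 (conditioning on clusters)] -/
theorem transform_atomC2ba (a b : V) (A : Finset V) {Z : Finset V} (ha : a ∉ Z) (Z' : Finset V) :
    transform₂ (atomC2ba K a b A) (corrK K) Z Z' =
      (if Even #(Z'.filter (· ∈ A)) then 0 else cw K b A (insert b (Z.filter (· ∈ A) ∪ Z'.filter (· ∈ A)))) *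
        corrK (cutCoupling K A) (insert a (Z.filter (· ∉ A))) * corrK (cutCoupling K A) (Z'.filter (· ∉ A)) := by
  unfold atomC2ba
  rw [transform_atoms, hfun hK]
  have hν : ∀ S ∈ Z.powerset, ∀ E ∈ Z'.powerset,
      (if Even #E then 0 else cw K b A (insert b (S ∪ E))) * spConv (nuA K A a) (corrK K) (Z \ S) *
        corrK (cutCoupling K A) (Z' \ E) =
      (if Even #E then 0 else cw K b A (insert b (S ∪ E))) * corrK (cutCoupling K A) (insert a (Z \ S)) *
        corrK (cutCoupling K A) (Z' \ E) := by
    intro S _ E _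
    rw [spConv_nuA_corrK hK A (fun h => ha (sdiff_subset h))]
  rw [sum_congr rfl fun S hS => sum_congr rfl fun E hE => hν S hS E hE]
  refine sum_powerset₂_collapse A (g₁ := fun R => corrK (cutCoupling K A) (insert a R))
    (fun S E hS => ?_) (fun S E hE => ?_)
    (fun R hR => corrK_cutCoupling_eq_zero K ?_) (fun R hR => corrK_cutCoupling_eq_zero K hR)
  · have : ¬ insert b (S ∪ E) ⊆ A := fun h => hS fun x hx => h (mem_insert_of_mem (mem_union_left _ hx))
    simp only [cw_eq_zero_of_not_subset K b this, ite_self]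
  · have : ¬ insert b (S ∪ E) ⊆ A := fun h => hE fun x hx => h (mem_insert_of_mem (mem_union_right _ hx))
    simp only [cw_eq_zero_of_not_subset K b this, ite_self]
  · exact fun h => hR (disjoint_of_subset_left (subset_insert a R) h)

end Transforms

/-! ### Small helpers for the case analysis -/

/-- `⟨σ_{R+b}⟩_A = 0` for `b ∈ A`. [folklore] -/
theorem corrK_cutCoupling_insert_eq_zero (K : G.edgeFinset → ℝ) {A : Finset V} {b : V} (hb : b ∈ A) (R : Finset V) :
    corrK (cutCoupling K A) (insert b R) = 0 :=
  corrK_cutCoupling_eq_zero K (not_disjoint_iff.2 ⟨b, mem_insert_self b R, hb⟩)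

omit [Fintype V] in
/-- `#Z'.filter (∉ A) + #Z'.filter (∈ A) = #Z'`. [folklore] -/
theorem card_filter_not_add (Z' A : Finset V) : #(Z'.filter (· ∉ A)) + #(Z'.filter (· ∈ A)) = #Z' := by
  rw [add_comm]; exact Finset.card_filter_add_card_filter_not (s := Z') (fun v => v ∈ A)

omit [Fintype V] in
/-- Inserting a fresh vertex into the off-`A` part. [folklore] -/
theorem card_insert_filter_not {Z' : Finset V} {b : V} (hb : b ∉ Z') (A : Finset V) :
    #(insert b (Z'.filter (· ∉ A))) = #(Z'.filter (· ∉ A)) + 1 :=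
  card_insert_of_notMem fun h => hb (mem_of_mem_filter b h)

/-! ### The first pair family: `(P,Q) = (∅,{a,b})` rooted at `a` -/

/-- **The first pair family identity**: for `a ≠ b` off `U ∪ U'`, `U ∩ U' = ∅`,
`𝟙[U = ∅] D_{ab}(U') = Σ_A (atomC1e + atomC1o)(U,U')`. [cite: Shlosman1986, §2] -/
theorem familyC1 (hK : ∀ e, 0 ≤ K e) {a b : V} (hab : a ≠ b) {U U' : Finset V} (haU : a ∉ U) (hbU : b ∉ U)
    (haU' : a ∉ U') (hbU' : b ∉ U') (hd : Disjoint U U') :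
    (if U = ∅ then Dab K a b U' else 0) = famC1Rhs K a b U U' := by
  refine deconv₂ (F := fun Y Y' => if Y = ∅ then Dab K a b Y' else (0 : ℝ)) (F' := famC1Rhs K a b)
    (spConv_corrK_spExp_neg hK) fun Z hZU Z' hZ'U' => ?_
  have haZ' : a ∉ Z' := fun h => haU' (hZ'U' h)
  have hbZ' : b ∉ Z' := fun h => hbU' (hZ'U' h)
  have haZ : a ∉ Z := fun h => haU (hZU h)
  have hbZ : b ∉ Z := fun h => hbU (hZU h)
  change transform₂ (fun Y Y' => if Y = ∅ then Dab K a b Y' else (0 : ℝ)) (corrK K) Z Z' =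
    transform₂ (famC1Rhs K a b) (corrK K) Z Z'
  rw [transform_C1Lhs hK hab Z haZ' hbZ', famC1Rhs, transform₂_sum]
  simp only [transform₂_add, transform_atomC1e hK, transform_atomC1o hK a b _ Z hbZ']
  have hpar := card_filter_not_add Z'
  rcases Nat.even_or_odd #Z' with hev | hodd
  · -- `#Z'` even: compare with (†') rooted at `a`
    have h𝒮 : Even #(insert a (insert b Z')) := by
      rw [card_insert_of_notMem (fun h => (mem_insert.1 h).elim hab haZ'), card_insert_of_notMem hbZ']
      rcases hev with ⟨k, hk⟩; exact ⟨k + 1, by omega⟩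
    have hdisj : Disjoint Z (insert a (insert b Z')) := by
      rw [disjoint_insert_right, disjoint_insert_right]
      exact ⟨haZ, hbZ, disjoint_of_subset_left hZU (disjoint_of_subset_right hZ'U' hd)⟩
    rw [corr_mul_corr_eq_sum_cw hK a hdisj h𝒮]
    refine sum_congr rfl fun A _ => ?_
    by_cases ha : a ∈ A
    · by_cases hb : b ∈ A
      · have hs : (Z ∪ insert a (insert b Z')).filter (· ∈ A) =
            insert a (insert b (Z.filter (· ∈ A) ∪ Z'.filter (· ∈ A))) := by
          rw [filter_union, filter_insert, if_pos ha, filter_insert, if_pos hb, union_insert, union_insert]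
        have hns : (insert a (insert b Z')).filter (· ∉ A) = Z'.filter (· ∉ A) := by
          rw [filter_insert, if_neg (fun h => h ha), filter_insert, if_neg (fun h => h hb)]
        rw [hs, hns, corrK_cutCoupling_insert_eq_zero K hb]
        by_cases hpe : Even #(Z'.filter (· ∈ A))
        · rw [if_pos hpe, if_pos hpe]; ring
        · have hodd' : Odd #(Z'.filter (· ∉ A)) := by
            have e1 := Nat.even_iff.1 hev; have e2 := Nat.odd_iff.1 (Nat.not_even_iff_odd.1 hpe)
            have := hpar A; exact Nat.odd_iff.2 (by omega)
          rw [if_neg hpe, if_neg hpe, corrK_eq_zero_of_odd _ hodd']; ring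
      · have hs : (Z ∪ insert a (insert b Z')).filter (· ∈ A) = insert a (Z.filter (· ∈ A) ∪ Z'.filter (· ∈ A)) := by
          rw [filter_union, filter_insert, if_pos ha, filter_insert, if_neg hb, union_insert]
        have hns : (insert a (insert b Z')).filter (· ∉ A) = insert b (Z'.filter (· ∉ A)) := by
          rw [filter_insert, if_neg (fun h => h ha), filter_insert, if_pos hb]
        have hcw : cw K a A (insert a (insert b (Z.filter (· ∈ A) ∪ Z'.filter (· ∈ A)))) = 0 :=
          cw_eq_zero_of_not_subset K a fun h => hb (h (mem_insert_of_mem (mem_insert_self _ _)))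
        rw [hs, hns, hcw]
        by_cases hpe : Even #(Z'.filter (· ∈ A))
        · have hodd' : Odd #(insert b (Z'.filter (· ∉ A))) := by
            rw [card_insert_filter_not hbZ']
            have e1 := Nat.even_iff.1 hev; have e2 := Nat.even_iff.1 hpe
            have := hpar A; exact Nat.odd_iff.2 (by omega)
          rw [if_pos hpe, if_pos hpe, corrK_eq_zero_of_odd _ hodd']; ring
        · rw [if_neg hpe, if_neg hpe]; ring
    · simp [cw_eq_zero_of_notMem K ha]
  · -- `#Z'` odd: both sides vanish
    have hodd𝒮 : Odd #(insert a (insert b Z')) := by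
      rw [card_insert_of_notMem (fun h => (mem_insert.1 h).elim hab haZ'), card_insert_of_notMem hbZ']
      rcases hodd with ⟨k, hk⟩; exact ⟨k + 1, by omega⟩
    rw [corrK_eq_zero_of_odd K hodd𝒮, mul_zero, eq_comm]
    refine sum_eq_zero fun A _ => ?_
    by_cases ha : a ∈ A
    · by_cases hpe : Even #(Z'.filter (· ∈ A))
      · have hodd' : Odd #(Z'.filter (· ∉ A)) := by
          have e1 := Nat.odd_iff.1 hodd; have e2 := Nat.even_iff.1 hpe
          have := hpar A; exact Nat.odd_iff.2 (by omega)
        rw [if_pos hpe, if_pos hpe, corrK_eq_zero_of_odd _ hodd']; ring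
      · by_cases hb : b ∈ A
        · rw [if_neg hpe, if_neg hpe, corrK_cutCoupling_insert_eq_zero K hb]; ring
        · have hodd' : Odd #(insert b (Z'.filter (· ∉ A))) := by
            rw [card_insert_filter_not hbZ']
            have e1 := Nat.odd_iff.1 hodd; have e2 := Nat.odd_iff.1 (Nat.not_even_iff_odd.1 hpe)
            have := hpar A; exact Nat.odd_iff.2 (by omega)
          rw [if_neg hpe, if_neg hpe, corrK_eq_zero_of_odd _ hodd']; ring
    · simp [cw_eq_zero_of_notMem K ha]

/-! ### The second pair family: `(P,Q) = ({a},{b})` rooted at `a` -/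

/-- **The second pair family identity** (root `a`): `u(U+a) u(U'+b) = Σ_A (atomC2ao + atomC2ae)(U,U')`.
[cite: Shlosman1986, §2] -/
theorem familyC2a (hK : ∀ e, 0 ≤ K e) {a b : V} (hab : a ≠ b) {U U' : Finset V} (haU : a ∉ U) (hbU : b ∉ U)
    (haU' : a ∉ U') (hbU' : b ∉ U') (hd : Disjoint U U') :
    uK K (insert a U) * uK K (insert b U') = famC2aRhs K a b U U' := by
  refine deconv₂ (F := fun Y Y' => uK K (insert a Y) * uK K (insert b Y')) (F' := famC2aRhs K a b)
    (spConv_corrK_spExp_neg hK) fun Z hZU Z' hZ'U' => ?_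
  have haZ' : a ∉ Z' := fun h => haU' (hZ'U' h)
  have hbZ' : b ∉ Z' := fun h => hbU' (hZ'U' h)
  have haZ : a ∉ Z := fun h => haU (hZU h)
  have hbZ : b ∉ Z := fun h => hbU (hZU h)
  change transform₂ (fun Y Y' => uK K (insert a Y) * uK K (insert b Y')) (corrK K) Z Z' =
    transform₂ (famC2aRhs K a b) (corrK K) Z Z'
  rw [transform_C2Lhs hK haZ hbZ', famC2aRhs, transform₂_sum]
  simp only [transform₂_add, transform_atomC2ao hK, transform_atomC2ae hK a b _ Z hbZ']
  have hpar := card_filter_not_add Z'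
  rcases Nat.even_or_odd #Z' with hev | hodd
  · -- `#Z'` even: `⟨σ_{Z'+b}⟩ = 0`, and every atom transform vanishes
    have hodd𝒮 : Odd #(insert b Z') := by
      rw [card_insert_of_notMem hbZ']; rcases hev with ⟨k, hk⟩; exact ⟨k, by omega⟩
    rw [corrK_eq_zero_of_odd K hodd𝒮, mul_zero, eq_comm]
    refine sum_eq_zero fun A _ => ?_
    by_cases ha : a ∈ A
    · by_cases hpe : Even #(Z'.filter (· ∈ A))
      · by_cases hb : b ∈ A
        · rw [if_pos hpe, if_pos hpe, corrK_cutCoupling_insert_eq_zero K hb]; ring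
        · have hodd' : Odd #(insert b (Z'.filter (· ∉ A))) := by
            rw [card_insert_filter_not hbZ']
            have e1 := Nat.even_iff.1 hev; have e2 := Nat.even_iff.1 hpe
            have := hpar A; exact Nat.odd_iff.2 (by omega)
          rw [if_pos hpe, if_pos hpe, corrK_eq_zero_of_odd _ hodd']; ring
      · have hodd' : Odd #(Z'.filter (· ∉ A)) := by
          have e1 := Nat.even_iff.1 hev; have e2 := Nat.odd_iff.1 (Nat.not_even_iff_odd.1 hpe)
          have := hpar A; exact Nat.odd_iff.2 (by omega)
        rw [if_neg hpe, if_neg hpe, corrK_eq_zero_of_odd _ hodd']; ring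
    · simp [cw_eq_zero_of_notMem K ha]
  · -- `#Z'` odd: compare with (†') rooted at `a`, `𝒯 = Z + a`, `𝒮 = Z' + b`
    have h𝒮 : Even #(insert b Z') := by
      rw [card_insert_of_notMem hbZ']; rcases hodd with ⟨k, hk⟩; exact ⟨k + 1, by omega⟩
    have hdisj : Disjoint (insert a Z) (insert b Z') := by
      rw [disjoint_insert_left, disjoint_insert_right]
      exact ⟨fun h => (mem_insert.1 h).elim hab haZ', hbZ, disjoint_of_subset_left hZU (disjoint_of_subset_right hZ'U' hd)⟩
    rw [corr_mul_corr_eq_sum_cw hK a hdisj h𝒮]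
    refine sum_congr rfl fun A _ => ?_
    by_cases ha : a ∈ A
    · have hnt : (insert a Z).filter (· ∉ A) = Z.filter (· ∉ A) := by rw [filter_insert, if_neg (fun h => h ha)]
      by_cases hb : b ∈ A
      · have hs : (insert a Z ∪ insert b Z').filter (· ∈ A) =
            insert a (insert b (Z.filter (· ∈ A) ∪ Z'.filter (· ∈ A))) := by
          rw [filter_union, filter_insert, if_pos ha, filter_insert, if_pos hb, insert_union, union_insert]
        have hns : (insert b Z').filter (· ∉ A) = Z'.filter (· ∉ A) := by rw [filter_insert, if_neg (fun h => h hb)]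
        rw [hs, hnt, hns, corrK_cutCoupling_insert_eq_zero K hb]
        by_cases hpe : Even #(Z'.filter (· ∈ A))
        · have hodd' : Odd #(Z'.filter (· ∉ A)) := by
            have e1 := Nat.odd_iff.1 hodd; have e2 := Nat.even_iff.1 hpe
            have := hpar A; exact Nat.odd_iff.2 (by omega)
          rw [if_pos hpe, if_pos hpe, corrK_eq_zero_of_odd _ hodd']; ring
        · rw [if_neg hpe, if_neg hpe]; ring
      · have hs : (insert a Z ∪ insert b Z').filter (· ∈ A) = insert a (Z.filter (· ∈ A) ∪ Z'.filter (· ∈ A)) := by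
          rw [filter_union, filter_insert, if_pos ha, filter_insert, if_neg hb, insert_union]
        have hns : (insert b Z').filter (· ∉ A) = insert b (Z'.filter (· ∉ A)) := by rw [filter_insert, if_pos hb]
        have hcw : cw K a A (insert a (insert b (Z.filter (· ∈ A) ∪ Z'.filter (· ∈ A)))) = 0 :=
          cw_eq_zero_of_not_subset K a fun h => hb (h (mem_insert_of_mem (mem_insert_self _ _)))
        rw [hs, hnt, hns, hcw]
        by_cases hpe : Even #(Z'.filter (· ∈ A))
        · rw [if_pos hpe, if_pos hpe]; ring
        · have hodd' : Odd #(insert b (Z'.filter (· ∉ A))) := by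
            rw [card_insert_filter_not hbZ']
            have e1 := Nat.odd_iff.1 hodd; have e2 := Nat.odd_iff.1 (Nat.not_even_iff_odd.1 hpe)
            have := hpar A; exact Nat.odd_iff.2 (by omega)
          rw [if_neg hpe, if_neg hpe, corrK_eq_zero_of_odd _ hodd']; ring
    · simp [cw_eq_zero_of_notMem K ha]

/-! ### The third pair family: `(P,Q) = ({a},{b})` rooted at `b` -/

/-- **The third pair family identity** (root `b`): `u(U+a) u(U'+b) = Σ_A (atomC2bo + atomC2ba)(U,U')`.
[cite: Shlosman1986, §2] -/
theorem familyC2b (hK : ∀ e, 0 ≤ K e) {a b : V} (hab : a ≠ b) {U U' : Finset V} (haU : a ∉ U) (hbU : b ∉ U)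
    (haU' : a ∉ U') (hbU' : b ∉ U') (hd : Disjoint U U') :
    uK K (insert a U) * uK K (insert b U') = famC2bRhs K a b U U' := by
  refine deconv₂ (F := fun Y Y' => uK K (insert a Y) * uK K (insert b Y')) (F' := famC2bRhs K a b)
    (spConv_corrK_spExp_neg hK) fun Z hZU Z' hZ'U' => ?_
  have haZ' : a ∉ Z' := fun h => haU' (hZ'U' h)
  have hbZ' : b ∉ Z' := fun h => hbU' (hZ'U' h)
  have haZ : a ∉ Z := fun h => haU (hZU h)
  have hbZ : b ∉ Z := fun h => hbU (hZU h)
  change transform₂ (fun Y Y' => uK K (insert a Y) * uK K (insert b Y')) (corrK K) Z Z' =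
    transform₂ (famC2bRhs K a b) (corrK K) Z Z'
  rw [transform_C2Lhs hK haZ hbZ', famC2bRhs, transform₂_sum]
  simp only [transform₂_add, transform_atomC2bo hK, transform_atomC2ba hK a b _ haZ Z']
  have hpar := card_filter_not_add Z'
  rcases Nat.even_or_odd #Z' with hev | hodd
  · -- `#Z'` even: everything vanishes
    have hodd𝒮 : Odd #(insert b Z') := by
      rw [card_insert_of_notMem hbZ']; rcases hev with ⟨k, hk⟩; exact ⟨k, by omega⟩
    rw [corrK_eq_zero_of_odd K hodd𝒮, mul_zero, eq_comm]
    refine sum_eq_zero fun A _ => ?_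
    by_cases hpe : Even #(Z'.filter (· ∈ A))
    · rw [if_pos hpe, if_pos hpe]; ring
    · have hodd' : Odd #(Z'.filter (· ∉ A)) := by
        have e1 := Nat.even_iff.1 hev; have e2 := Nat.odd_iff.1 (Nat.not_even_iff_odd.1 hpe)
        have := hpar A; exact Nat.odd_iff.2 (by omega)
      rw [corrK_eq_zero_of_odd _ hodd']; ring
  · -- `#Z'` odd: compare with (†') rooted at `b`
    have h𝒮 : Even #(insert b Z') := by
      rw [card_insert_of_notMem hbZ']; rcases hodd with ⟨k, hk⟩; exact ⟨k + 1, by omega⟩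
    have hdisj : Disjoint (insert a Z) (insert b Z') := by
      rw [disjoint_insert_left, disjoint_insert_right]
      exact ⟨fun h => (mem_insert.1 h).elim hab haZ', hbZ, disjoint_of_subset_left hZU (disjoint_of_subset_right hZ'U' hd)⟩
    rw [corr_mul_corr_eq_sum_cw hK b hdisj h𝒮]
    refine sum_congr rfl fun A _ => ?_
    by_cases hb : b ∈ A
    · have hns : (insert b Z').filter (· ∉ A) = Z'.filter (· ∉ A) := by rw [filter_insert, if_neg (fun h => h hb)]
      by_cases ha : a ∈ A
      · have hs : (insert a Z ∪ insert b Z').filter (· ∈ A) =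
            insert a (insert b (Z.filter (· ∈ A) ∪ Z'.filter (· ∈ A))) := by
          rw [filter_union, filter_insert, if_pos ha, filter_insert, if_pos hb, insert_union, union_insert]
        have hnt : (insert a Z).filter (· ∉ A) = Z.filter (· ∉ A) := by rw [filter_insert, if_neg (fun h => h ha)]
        rw [hs, hnt, hns, corrK_cutCoupling_insert_eq_zero K ha]
        by_cases hpe : Even #(Z'.filter (· ∈ A))
        · have hodd' : Odd #(Z'.filter (· ∉ A)) := by
            have e1 := Nat.odd_iff.1 hodd; have e2 := Nat.even_iff.1 hpe
            have := hpar A; exact Nat.odd_iff.2 (by omega)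
          rw [if_pos hpe, if_pos hpe, corrK_eq_zero_of_odd _ hodd']; ring
        · rw [if_neg hpe, if_neg hpe]; ring
      · have hs : (insert a Z ∪ insert b Z').filter (· ∈ A) = insert b (Z.filter (· ∈ A) ∪ Z'.filter (· ∈ A)) := by
          rw [filter_union, filter_insert, if_neg ha, filter_insert, if_pos hb, union_insert]
        have hnt : (insert a Z).filter (· ∉ A) = insert a (Z.filter (· ∉ A)) := by rw [filter_insert, if_pos ha]
        have hcw : cw K b A (insert a (insert b (Z.filter (· ∈ A) ∪ Z'.filter (· ∈ A)))) = 0 :=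
          cw_eq_zero_of_not_subset K b fun h => ha (h (mem_insert_self _ _))
        rw [hs, hnt, hns, hcw]
        by_cases hpe : Even #(Z'.filter (· ∈ A))
        · have hodd' : Odd #(Z'.filter (· ∉ A)) := by
            have e1 := Nat.odd_iff.1 hodd; have e2 := Nat.even_iff.1 hpe
            have := hpar A; exact Nat.odd_iff.2 (by omega)
          rw [if_pos hpe, if_pos hpe, corrK_eq_zero_of_odd _ hodd']; ring
        · rw [if_neg hpe, if_neg hpe]; ring
    · simp [cw_eq_zero_of_notMem K hb]

end Current

end Literature.Probability.LatticeModels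

end

/-!
# Part 2 — the sign recursion (master identity B)

  From the rooted family identity
`Current.familyA` (all splittings `(U, U')` of `W ∖ w₀`) we derive, by the *affine diagonal collapse* with the
multipliers `μ(U') = (2m-1) - 2·#U'`, the **sign recursion** (`Current.masterB`, evidence "full_proof.md", Thm B):
for `#W = 2m`, `w₀ ∈ W`,

  `(2m - 1) · u(W) = Σ_{x ∈ W ∖ w₀} Σ_A cw_A({w₀, x}) · e_A^{(2)}((W ∖ w₀) ∖ x)`,
  `e_A^{(2)} = exp(-2 δ_A u) = Σ_π (-2)^{|π|} ∏_{V ∈ π} δ_A u(V)`.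

Only the atoms with exactly two `t`-sources survive: for a source footprint `T` with `#T ≥ 2` the affine collapse
produces the factor `Σ_{E ⊆ T, #E even} (#T - 2 #E) = 0` (`sum_filter_even_card_sub_two_mul_card`).  With
`cw ≥ 0` and the inductive signs of `δ_A u`, this is Shlosman's sign theorem `(-1)^{m-1} u_{2m} ≥ 0` (Part 4).

## References

* S. B. Shlosman, *Signs of the Ising model Ursell functions*, Comm. Math. Phys. 102 (1986) 679–686 [Shlosman1986];
  F. Camia, J. Jiang, C. M. Newman, Comm. Math. Phys. 401 (2023), arXiv:2207.12247 [CamiaJiangNewman2023].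
-/

noncomputable section

open Finset Filter
open scoped symmDiff ENNReal

namespace Literature.Probability.LatticeModels

/-! ### Generic: the four-piece reindexing and two binomial identities -/

section Generic

variable {α : Type*} [DecidableEq α]

/-- Reindexing `(U ⊇ S) ↦ (S, U ∖ S)`. [folklore] -/
theorem sum_powerset_powerset_eq {M : Type*} [AddCommMonoid M] (Y : Finset α) (g : Finset α → Finset α → M) :
    ∑ U ∈ Y.powerset, ∑ S ∈ U.powerset, g S (U \ S) = ∑ S ∈ Y.powerset, ∑ R ∈ (Y \ S).powerset, g S R := by
  rw [sum_sigma', sum_sigma']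
  refine sum_nbij' (fun x => (⟨x.2, x.1 \ x.2⟩ : Σ _ : Finset α, Finset α))
    (fun y => (⟨y.1 ∪ y.2, y.1⟩ : Σ _ : Finset α, Finset α)) ?_ ?_ ?_ ?_ ?_
  · rintro ⟨U, S⟩ hx
    simp only [mem_sigma, mem_powerset] at hx ⊢
    exact ⟨hx.2.trans hx.1, sdiff_subset_sdiff hx.1 le_rfl⟩
  · rintro ⟨S, R⟩ hy
    simp only [mem_sigma, mem_powerset] at hy ⊢
    exact ⟨union_subset hy.1 (hy.2.trans sdiff_subset), subset_union_left⟩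
  · rintro ⟨U, S⟩ hx
    simp only [mem_sigma, mem_powerset] at hx
    dsimp only
    rw [union_sdiff_of_subset hx.2]
  · rintro ⟨S, R⟩ hy
    simp only [mem_sigma, mem_powerset] at hy
    have hd : Disjoint S R := disjoint_of_subset_right hy.2 disjoint_sdiff
    dsimp only
    rw [union_sdiff_cancel_left hd]
  · rintro ⟨U, S⟩ _
    rfl

/-- Exchanging the order of two nested sums over disjoint subsets. [folklore] -/
theorem sum_powerset_sdiff_comm {M : Type*} [AddCommMonoid M] (Y : Finset α) (f : Finset α → Finset α → M) :
    ∑ R ∈ Y.powerset, ∑ E ∈ (Y \ R).powerset, f R E = ∑ E ∈ Y.powerset, ∑ R ∈ (Y \ E).powerset, f R E := by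
  rw [sum_sigma', sum_sigma']
  refine sum_nbij' (fun x => (⟨x.2, x.1⟩ : Σ _ : Finset α, Finset α))
    (fun y => (⟨y.2, y.1⟩ : Σ _ : Finset α, Finset α)) ?_ ?_ ?_ ?_ ?_
  · rintro ⟨R, E⟩ hx
    simp only [mem_sigma, mem_powerset] at hx ⊢
    exact ⟨hx.2.trans sdiff_subset, fun v hv => Finset.mem_sdiff.2 ⟨hx.1 hv, fun hvE => (Finset.mem_sdiff.1 (hx.2 hvE)).2 hv⟩⟩
  · rintro ⟨E, R⟩ hy
    simp only [mem_sigma, mem_powerset] at hy ⊢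
    exact ⟨hy.2.trans sdiff_subset, fun v hv => Finset.mem_sdiff.2 ⟨hy.1 hv, fun hvR => (Finset.mem_sdiff.1 (hy.2 hvR)).2 hv⟩⟩
  · rintro ⟨R, E⟩ _; rfl
  · rintro ⟨E, R⟩ _; rfl
  · rintro ⟨R, E⟩ _; rfl

/-- **Four-piece reindexing.**  Splitting `Y = U ⊔ U'` and then `U = S ⊔ R₁`, `U' = E ⊔ R₂` is the same as choosing the
footprint `T = S ⊔ E`, then `E ⊆ T`, then `R₁ ⊆ Y ∖ T` (`R₂` is the rest). [folklore] -/
theorem sum_powerset_split₄ {M : Type*} [AddCommMonoid M] (Y : Finset α)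
    (H : Finset α → Finset α → Finset α → Finset α → M) :
    ∑ U ∈ Y.powerset, ∑ S ∈ U.powerset, ∑ E ∈ (Y \ U).powerset, H S E (U \ S) ((Y \ U) \ E) =
      ∑ T ∈ Y.powerset, ∑ E ∈ T.powerset, ∑ R ∈ (Y \ T).powerset, H (T \ E) E R ((Y \ T) \ R) := by
  -- (1) `Y \ U = (Y \ S) \ (U \ S)`, reindex `(U, S) ↦ (S, R₁ = U \ S)`
  have step1 : ∑ U ∈ Y.powerset, ∑ S ∈ U.powerset, ∑ E ∈ (Y \ U).powerset, H S E (U \ S) ((Y \ U) \ E) =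
      ∑ S ∈ Y.powerset, ∑ R₁ ∈ (Y \ S).powerset, ∑ E ∈ ((Y \ S) \ R₁).powerset, H S E R₁ (((Y \ S) \ R₁) \ E) := by
    rw [← sum_powerset_powerset_eq Y (fun S R₁ => ∑ E ∈ ((Y \ S) \ R₁).powerset, H S E R₁ (((Y \ S) \ R₁) \ E))]
    refine sum_congr rfl fun U _ => sum_congr rfl fun S hS => ?_
    show _ = ∑ E ∈ ((Y \ S) \ (U \ S)).powerset, H S E (U \ S) (((Y \ S) \ (U \ S)) \ E)
    rw [sdiff_sdiff_sdiff_of_subset (mem_powerset.1 hS)]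
  -- (2) exchange the `R₁`- and `E`-sums
  have step2 : ∀ S ∈ Y.powerset, ∑ R₁ ∈ (Y \ S).powerset, ∑ E ∈ ((Y \ S) \ R₁).powerset, H S E R₁ (((Y \ S) \ R₁) \ E) =
      ∑ E ∈ (Y \ S).powerset, ∑ R₁ ∈ ((Y \ S) \ E).powerset, H S E R₁ (((Y \ S) \ E) \ R₁) := by
    intro S _
    rw [sum_powerset_sdiff_comm (Y \ S) (fun R₁ E => H S E R₁ (((Y \ S) \ R₁) \ E))]
    refine sum_congr rfl fun E _ => sum_congr rfl fun R₁ _ => ?_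
    show H S E R₁ (((Y \ S) \ R₁) \ E) = _
    rw [sdiff_right_comm]
  rw [step1, sum_congr rfl step2]
  -- (3) regroup `(S, E)` into the footprint `T = S ∪ E`
  rw [sum_powerset_sdiff_comm Y (fun S E => ∑ R₁ ∈ ((Y \ S) \ E).powerset, H S E R₁ (((Y \ S) \ E) \ R₁)),
    ← sum_powerset_powerset_eq Y (fun E S => ∑ R₁ ∈ ((Y \ S) \ E).powerset, H S E R₁ (((Y \ S) \ E) \ R₁))]
  refine sum_congr rfl fun T _ => sum_congr rfl fun E hE => ?_
  show ∑ R₁ ∈ ((Y \ (T \ E)) \ E).powerset, H (T \ E) E R₁ (((Y \ (T \ E)) \ E) \ R₁) = _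
  have hset : (Y \ (T \ E)) \ E = Y \ T := by
    rw [sdiff_sdiff_left, sup_eq_union, sdiff_union_of_subset (mem_powerset.1 hE)]
  rw [hset]

/-- `Σ_{E ⊆ T} (#T - 2 #E) = 0` (complementation reverses the sign). [folklore] -/
theorem sum_powerset_card_sub_two_mul_card (T : Finset α) :
    ∑ E ∈ T.powerset, ((#T : ℝ) - 2 * #E) = 0 := by
  have h : ∑ E ∈ T.powerset, ((#T : ℝ) - 2 * #E) = ∑ E ∈ T.powerset, -((#T : ℝ) - 2 * #E) := by
    refine sum_nbij' (fun E => T \ E) (fun E => T \ E) ?_ ?_ ?_ ?_ ?_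
    · intro E _; exact mem_powerset.2 sdiff_subset
    · intro E _; exact mem_powerset.2 sdiff_subset
    · intro E hE; exact Finset.sdiff_sdiff_eq_self (mem_powerset.1 hE)
    · intro E hE; exact Finset.sdiff_sdiff_eq_self (mem_powerset.1 hE)
    · intro E hE
      rw [card_sdiff_of_subset (mem_powerset.1 hE), Nat.cast_sub (card_le_card (mem_powerset.1 hE))]
      ring
  rw [sum_neg_distrib] at h
  linarith

/-- `Σ_{E ⊆ T} (-1)^{#E} (#T - 2 #E) = 0` for `#T ≥ 2` (toggle a point of `T`). [folklore] -/
theorem sum_powerset_neg_one_pow_mul_card_sub (T : Finset α) (hT : 2 ≤ #T) :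
    ∑ E ∈ T.powerset, (-1 : ℝ) ^ #E * ((#T : ℝ) - 2 * #E) = 0 := by
  obtain ⟨x, hx⟩ : T.Nonempty := card_pos.1 (by omega)
  have hT' : (T.erase x).Nonempty := card_pos.1 (by rw [card_erase_of_mem hx]; omega)
  rw [← insert_erase hx, sum_powerset_insert (notMem_erase x T), ← sum_add_distrib]
  have hpair : ∀ E ∈ (T.erase x).powerset,
      (-1 : ℝ) ^ #E * ((#(insert x (T.erase x)) : ℝ) - 2 * #E) +
        (-1 : ℝ) ^ #(insert x E) * ((#(insert x (T.erase x)) : ℝ) - 2 * #(insert x E)) = 2 * (-1 : ℝ) ^ #E := by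
    intro E hE
    have hxE : x ∉ E := fun h => notMem_erase x T (mem_powerset.1 hE h)
    rw [card_insert_of_notMem hxE, pow_succ]
    push_cast
    ring
  rw [sum_congr rfl hpair, ← mul_sum]
  have h0 := sum_powerset_neg_one_pow_card_of_nonempty hT'
  have h0' : ∑ E ∈ (T.erase x).powerset, (-1 : ℝ) ^ #E = 0 := by exact_mod_cast h0
  rw [h0', mul_zero]

/-- **The key cancellation**: `Σ_{E ⊆ T, #E even} (#T - 2 #E) = 𝟙[#T = 1]`. [folklore] -/
theorem sum_filter_even_card_sub_two_mul_card (T : Finset α) :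
    ∑ E ∈ T.powerset with Even #E, ((#T : ℝ) - 2 * #E) = if #T = 1 then 1 else 0 := by
  by_cases h1 : #T = 1
  · obtain ⟨x, rfl⟩ := card_eq_one.1 h1
    rw [if_pos h1]
    have : ({x} : Finset α).powerset.filter (fun E => Even #E) = {∅} := by
      ext E
      simp only [mem_filter, mem_powerset, subset_singleton_iff, mem_singleton]
      constructor
      · rintro ⟨rfl | rfl, hE⟩
        · rfl
        · simp at hE
      · rintro rfl; exact ⟨Or.inl rfl, by simp⟩
    rw [this, sum_singleton]
    simp
  · rw [if_neg h1]
    -- `2 Σ_{even} f = Σ f + Σ (-1)^{#E} f`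
    have hsplit : ∀ E : Finset α, (if Even #E then ((#T : ℝ) - 2 * #E) else 0) =
        (1 / 2) * (((#T : ℝ) - 2 * #E) + (-1 : ℝ) ^ #E * ((#T : ℝ) - 2 * #E)) := by
      intro E
      rcases Nat.even_or_odd #E with he | ho
      · rw [if_pos he, he.neg_one_pow]; ring
      · rw [if_neg (Nat.not_even_iff_odd.2 ho), ho.neg_one_pow]; ring
    rw [sum_filter, sum_congr rfl fun E _ => hsplit E, ← mul_sum, sum_add_distrib,
      sum_powerset_card_sub_two_mul_card]
    rcases Nat.lt_or_ge #T 2 with hlt | hge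
    · -- `#T = 0`
      have h0 : #T = 0 := by omega
      rw [card_eq_zero.1 h0]
      simp
    · rw [sum_powerset_neg_one_pow_mul_card_sub T hge]; simp

omit [DecidableEq α] in
/-- Sums over the singletons of `Y`. [folklore] -/
theorem sum_powerset_ite_card_eq_one {M : Type*} [AddCommMonoid M] (Y : Finset α) (g : Finset α → M) :
    ∑ T ∈ Y.powerset, (if #T = 1 then g T else 0) = ∑ x ∈ Y, g {x} := by
  rw [← sum_filter, ← powersetCard_eq_filter, powersetCard_one, sum_map]
  rfl

/-- The symmetric weighted collapse with the weight on the complement. [folklore] -/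
theorem two_mul_sum_card_sdiff_mul {C : Type*} [CommRing C] (f : Finset α → C) (Y : Finset α) :
    2 * ∑ Z ∈ Y.powerset, ((Y \ Z).card : C) * (f Z * f (Y \ Z)) = (Y.card : C) * ∑ Z ∈ Y.powerset, f Z * f (Y \ Z) := by
  have h := two_mul_sum_card_mul (fun Z Z' => f Z * f Z') Y (fun Z _ => mul_comm _ _)
  -- flip `Z ↦ Y \ Z` in the weighted sum
  have hflip : ∑ Z ∈ Y.powerset, ((Y \ Z).card : C) * (f Z * f (Y \ Z)) =
      ∑ Z ∈ Y.powerset, (Z.card : C) * (f Z * f (Y \ Z)) := by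
    refine sum_nbij' (fun Z => Y \ Z) (fun Z => Y \ Z) ?_ ?_ ?_ ?_ ?_
    · intro Z _; exact mem_powerset.2 sdiff_subset
    · intro Z _; exact mem_powerset.2 sdiff_subset
    · intro Z hZ; exact Finset.sdiff_sdiff_eq_self (mem_powerset.1 hZ)
    · intro Z hZ; exact Finset.sdiff_sdiff_eq_self (mem_powerset.1 hZ)
    · intro Z hZ; rw [Finset.sdiff_sdiff_eq_self (mem_powerset.1 hZ), mul_comm (f Z)]
  rw [hflip, h]

end Generic

variable {V : Type*} [Fintype V] [DecidableEq V] {G : SimpleGraph V} [DecidableRel G.Adj]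

namespace Current

variable {K : G.edgeFinset → ℝ}

/-- `Σ_{R ⊆ Z} e_A(R) e_A(Z ∖ R) = e_A^{(2)}(Z)`. [folklore] -/
theorem sum_powerset_eA_mul_eA (K : G.edgeFinset → ℝ) (A Z : Finset V) :
    ∑ R ∈ Z.powerset, eA K A 1 R * eA K A 1 (Z \ R) = eA K A 2 Z := by
  rw [eA, sum_powerset_spExp_mul_spExp, eA]
  congr 1
  funext B
  simp only [Pi.add_apply]
  ring

/-- **Master identity B (the sign recursion).**  For `#W = 2m ≥ 2` and `w₀ ∈ W`,
`(2m-1) u(W) = Σ_{x ∈ W∖w₀} Σ_A cw_A({w₀,x}) e_A^{(2)}((W∖w₀)∖x)`.  Proof: sum the rooted family identity over all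
splittings `U ⊔ U' = W ∖ w₀` with the affine weights `(2m-1) - 2#U'`; after the four-piece reindexing the weight of a
footprint `T` is `e^{(2)}(rest) · Σ_{E ⊆ T even} (#T - 2#E) = e^{(2)}(rest) · 𝟙[#T = 1]`. [cite: Shlosman1986, §2] -/
theorem masterB (hK : ∀ e, 0 ≤ K e) {W : Finset V} {m : ℕ} (hW : #W = 2 * m) {w₀ : V} (hw₀ : w₀ ∈ W) :
    ((2 * m - 1 : ℕ) : ℝ) * uK K W =
      ∑ x ∈ W.erase w₀, ∑ A : Finset V, cw K w₀ A {w₀, x} * eA K A 2 ((W.erase w₀).erase x) := by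
  set Y := W.erase w₀ with hY
  have hwY : w₀ ∉ Y := notMem_erase w₀ W
  have hYW : insert w₀ Y = W := insert_erase hw₀
  have hm : 1 ≤ m := by
    have := card_pos.2 ⟨w₀, hw₀⟩; omega
  have hcardY : #Y = 2 * m - 1 := by rw [hY, card_erase_of_mem hw₀, hW]
  -- the affine multiplier
  set μ : ℕ → ℝ := fun j => ((2 * m - 1 : ℕ) : ℝ) - 2 * j with hμ
  -- Step 1: the weighted sum of the left-hand sides is `μ 0 · u(W)`
  have hL : ∑ U ∈ Y.powerset, μ #(Y \ U) * (if Y \ U = ∅ then uK K (insert w₀ U) else 0) =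
      ((2 * m - 1 : ℕ) : ℝ) * uK K W := by
    rw [sum_eq_single_of_mem Y (mem_powerset.2 subset_rfl)]
    · rw [Finset.sdiff_self, if_pos rfl, hYW]; simp [hμ]
    · intro U hU hne
      have : Y \ U ≠ ∅ := fun h => hne (subset_antisymm (mem_powerset.1 hU) (sdiff_eq_empty_iff_subset.1 h))
      rw [if_neg this, mul_zero]
  -- Step 2: replace each left-hand side by the family right-hand side
  have hfam : ∀ U ∈ Y.powerset, μ #(Y \ U) * (if Y \ U = ∅ then uK K (insert w₀ U) else 0) =
      μ #(Y \ U) * famARhs K w₀ U (Y \ U) := by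
    intro U hU
    have hUY := mem_powerset.1 hU
    rw [familyA hK w₀ (fun h => hwY (hUY h)) (fun h => hwY (sdiff_subset h)) disjoint_sdiff]
  rw [← hL, sum_congr rfl hfam]
  -- Step 3: expand, exchange the `A`-sum, and reindex by the footprint
  unfold famARhs
  simp_rw [mul_sum]
  rw [sum_comm]
  conv_rhs => rw [sum_comm]
  refine sum_congr rfl fun A _ => ?_
  -- rewrite the weight as a function of the four pieces
  have hw4 : ∀ U ∈ Y.powerset, ∀ S ∈ U.powerset, ∀ E ∈ (Y \ U).powerset,
      μ #(Y \ U) * ((if Even #E then cw K w₀ A (insert w₀ (S ∪ E)) else 0) * eA K A 1 (U \ S) * eA K A 1 ((Y \ U) \ E)) =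
      (fun S E R₁ R₂ => μ (#E + #R₂) * ((if Even #E then cw K w₀ A (insert w₀ (S ∪ E)) else 0) *
        eA K A 1 R₁ * eA K A 1 R₂)) S E (U \ S) ((Y \ U) \ E) := by
    intro U _ S _ E hE
    show _ = μ (#E + #((Y \ U) \ E)) * _
    rw [add_comm #E, card_sdiff_add_card_eq_card (mem_powerset.1 hE)]
  rw [sum_congr rfl fun U hU => sum_congr rfl fun S hS => sum_congr rfl fun E hE => hw4 U hU S hS E hE,
    sum_powerset_split₄ Y (fun S E R₁ R₂ => μ (#E + #R₂) * ((if Even #E then cw K w₀ A (insert w₀ (S ∪ E)) else 0) *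
        eA K A 1 R₁ * eA K A 1 R₂))]
  -- Step 4: for each footprint `T`, the affine collapse
  have hT : ∀ T ∈ Y.powerset, ∑ E ∈ T.powerset, ∑ R ∈ (Y \ T).powerset,
      μ (#E + #((Y \ T) \ R)) * ((if Even #E then cw K w₀ A (insert w₀ (T \ E ∪ E)) else 0) *
        eA K A 1 R * eA K A 1 ((Y \ T) \ R)) =
      (if #T = 1 then cw K w₀ A (insert w₀ T) * eA K A 2 (Y \ T) else 0) := by
    intro T hT
    have hTY := mem_powerset.1 hT
    have hcT : (#(Y \ T) : ℝ) = ((2 * m - 1 : ℕ) : ℝ) - #T := by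
      rw [card_sdiff_of_subset hTY, Nat.cast_sub (card_le_card hTY), hcardY]
    -- the inner `R`-sum
    have hR : ∀ E ∈ T.powerset, ∑ R ∈ (Y \ T).powerset,
        μ (#E + #((Y \ T) \ R)) * ((if Even #E then cw K w₀ A (insert w₀ (T \ E ∪ E)) else 0) *
          eA K A 1 R * eA K A 1 ((Y \ T) \ R)) =
        (if Even #E then cw K w₀ A (insert w₀ T) else 0) * (((#T : ℝ) - 2 * #E) * eA K A 2 (Y \ T)) := by
      intro E hE
      rw [sdiff_union_of_subset (mem_powerset.1 hE)]
      have hexp : ∀ R ∈ (Y \ T).powerset,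
          μ (#E + #((Y \ T) \ R)) * ((if Even #E then cw K w₀ A (insert w₀ T) else 0) * eA K A 1 R * eA K A 1 ((Y \ T) \ R)) =
          (if Even #E then cw K w₀ A (insert w₀ T) else 0) *
            ((((2 * m - 1 : ℕ) : ℝ) - 2 * #E) * (eA K A 1 R * eA K A 1 ((Y \ T) \ R)) -
              (2 * (#((Y \ T) \ R) : ℝ) * (eA K A 1 R * eA K A 1 ((Y \ T) \ R)))) := by
        intro R _
        simp only [hμ, Nat.cast_add]
        ring
      rw [sum_congr rfl hexp, ← mul_sum, sum_sub_distrib, ← mul_sum, sum_powerset_eA_mul_eA]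
      have h2 : ∑ R ∈ (Y \ T).powerset, 2 * (#((Y \ T) \ R) : ℝ) * (eA K A 1 R * eA K A 1 ((Y \ T) \ R)) =
          (#(Y \ T) : ℝ) * eA K A 2 (Y \ T) := by
        rw [← sum_powerset_eA_mul_eA, ← two_mul_sum_card_sdiff_mul, mul_sum]
        exact sum_congr rfl fun R _ => by ring
      rw [h2, hcT]
      ring
    rw [sum_congr rfl hR]
    -- the `E`-sum: only `#T = 1` survives
    have hE : ∑ E ∈ T.powerset, (if Even #E then cw K w₀ A (insert w₀ T) else 0) * (((#T : ℝ) - 2 * #E) * eA K A 2 (Y \ T)) =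
        (cw K w₀ A (insert w₀ T) * eA K A 2 (Y \ T)) * ∑ E ∈ T.powerset with Even #E, ((#T : ℝ) - 2 * #E) := by
      rw [sum_filter, mul_sum]
      refine sum_congr rfl fun E _ => ?_
      split_ifs <;> ring
    rw [hE, sum_filter_even_card_sub_two_mul_card]
    split_ifs <;> ring
  rw [sum_congr rfl hT, sum_powerset_ite_card_eq_one]
  refine sum_congr rfl fun x _ => ?_
  rw [sdiff_singleton_eq_erase]

end Current

end Literature.Probability.LatticeModels

end

/-!
# Part 3 — the master identity for `∂u/∂J_{ab}` (master identity C)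

Continues Parts 1 and 2.
With `D_{ab}(X) = u(X+a+b) + Σ_{S ⊆ X} u(S+a) u((X∖S)+b)` (`Current.Dab`, the algebraic form of `∂u/∂J_{ab}`,
Camia–Jiang–Newman 2023 eq. (20)) and `ν²_{A,b}(R) = Σ_{Z ⊆ R} u_A(Z + b) e_A^{(2)}(R ∖ Z)` (`Current.nu2`) we prove the
**master identity C** (`Current.masterC`, evidence "full_proof.md", Thm C): for `#X = 2m`, `a ≠ b ∉ X`,

  `2m · D_{ab}(X) = Σ_{x ∈ X} Σ_A ( cw_A^{(a)}({a,x}) ν²_{A,b}(X ∖ x) + cw_A^{(b)}({b,x}) ν²_{A,a}(X ∖ x) )`.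

It is the affine diagonal collapse, over all splittings `U ⊔ U' = X`, of the certificate
`(2#U' - 2m)·(familyC1 rooted at a + familyC1 rooted at b) + (2m - 2#U')·(familyC2a - familyC2b)`:
the atoms with both `a, b` among the sources cancel between the two roots, and for the remaining atoms the
`E`-parity sums collapse to `𝟙[#T = 1]` (`UrsellSignRecursion.sum_filter_even_card_sub_two_mul_card` and its odd and
alternating companions).  Together with `masterB` this drives the joint induction on the order (Part 4).

## References

* F. Camia, J. Jiang, C. M. Newman, Comm. Math. Phys. 401 (2023), arXiv:2207.12247, Thm 1.1 and eq. (20)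
  [CamiaJiangNewman2023]; S. B. Shlosman, Comm. Math. Phys. 102 (1986) 679–686 [Shlosman1986].
-/

noncomputable section

open Finset Filter
open scoped symmDiff ENNReal

namespace Literature.Probability.LatticeModels

/-! ### Generic: affine collapses of the three atom shapes, and parity sums -/

section Generic

variable {α : Type*} [DecidableEq α]

/-- `Σ_{E ⊆ T, #E odd} (#T - 2 #E) = -𝟙[#T = 1]`. [folklore] -/
theorem sum_filter_odd_card_sub_two_mul_card (T : Finset α) :
    ∑ E ∈ T.powerset with ¬ Even #E, ((#T : ℝ) - 2 * #E) = -(if #T = 1 then 1 else 0) := by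
  have h := sum_filter_add_sum_filter_not T.powerset (fun E => Even #E) (fun E => ((#T : ℝ) - 2 * #E))
  rw [sum_powerset_card_sub_two_mul_card, sum_filter_even_card_sub_two_mul_card] at h
  linarith

/-- `Σ_{E ⊆ T} (-1)^{#E} = 𝟙[T = ∅]` in `ℝ`. [folklore] -/
theorem sum_powerset_neg_one_pow_card_real (T : Finset α) :
    ∑ E ∈ T.powerset, (-1 : ℝ) ^ #E = if T = ∅ then 1 else 0 := by
  have h := (sum_powerset_neg_one_pow_card (x := T))
  split_ifs at h with hT
  · rw [if_pos hT]; exact_mod_cast h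
  · rw [if_neg hT]; exact_mod_cast h

/-- The alternating sum of an affine function of `#E`:
`Σ_{E ⊆ T} (-1)^{#E} (c + d #E) = c 𝟙[T = ∅] - d 𝟙[#T = 1]`. [folklore] -/
theorem sum_powerset_neg_one_pow_affine (T : Finset α) (c d : ℝ) :
    ∑ E ∈ T.powerset, (-1 : ℝ) ^ #E * (c + d * #E) =
      c * (if T = ∅ then 1 else 0) - d * (if #T = 1 then 1 else 0) := by
  -- even part minus odd part
  have hsplit : ∀ E : Finset α, (-1 : ℝ) ^ #E * (c + d * #E) =
      (if Even #E then (c + d * #E) else 0) - (if ¬ Even #E then (c + d * #E) else 0) := by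
    intro E
    by_cases he : Even #E
    · rw [if_pos he, if_neg (not_not.2 he), he.neg_one_pow]; ring
    · rw [if_neg he, if_pos he, (Nat.not_even_iff_odd.1 he).neg_one_pow]; ring
  rw [sum_congr rfl fun E _ => hsplit E, sum_sub_distrib, ← sum_filter, ← sum_filter]
  -- express through the two key sums and the plain counts
  have hE : ∑ E ∈ T.powerset with Even #E, (c + d * #E) =
      (c + d * #T / 2) * ∑ E ∈ T.powerset with Even #E, (1 : ℝ) - (d / 2) * ∑ E ∈ T.powerset with Even #E, ((#T : ℝ) - 2 * #E) := by
    rw [mul_sum, mul_sum, ← sum_sub_distrib]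
    exact sum_congr rfl fun E _ => by ring
  have hO : ∑ E ∈ T.powerset with ¬ Even #E, (c + d * #E) =
      (c + d * #T / 2) * ∑ E ∈ T.powerset with ¬ Even #E, (1 : ℝ) - (d / 2) * ∑ E ∈ T.powerset with ¬ Even #E, ((#T : ℝ) - 2 * #E) := by
    rw [mul_sum, mul_sum, ← sum_sub_distrib]
    exact sum_congr rfl fun E _ => by ring
  have hcount : ∑ E ∈ T.powerset with Even #E, (1 : ℝ) - ∑ E ∈ T.powerset with ¬ Even #E, (1 : ℝ) =
      if T = ∅ then 1 else 0 := by
    rw [← sum_powerset_neg_one_pow_card_real, sum_filter, sum_filter, ← sum_sub_distrib]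
    refine sum_congr rfl fun E _ => ?_
    by_cases he : Even #E
    · rw [if_pos he, if_neg (not_not.2 he), he.neg_one_pow]; ring
    · rw [if_neg he, if_pos he, (Nat.not_even_iff_odd.1 he).neg_one_pow]; ring
  rw [hE, hO, sum_filter_even_card_sub_two_mul_card, sum_filter_odd_card_sub_two_mul_card]
  have : (c + d * #T / 2) * (∑ E ∈ T.powerset with Even #E, (1 : ℝ)) - (c + d * #T / 2) * (∑ E ∈ T.powerset with ¬ Even #E, (1 : ℝ)) =
      (c + d * #T / 2) * (if T = ∅ then 1 else 0) := by rw [← mul_sub, hcount]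
  by_cases hT : T = ∅
  · subst hT; simp [Finset.filter_singleton]
  · rw [if_neg hT] at this ⊢
    split_ifs with h1 <;> linarith

variable (e e₂ ub : Finset α → ℝ) (μ : ℕ → ℝ) (αc βc : ℝ)

/-- **Affine collapse, shape `(e, e)`.**  For `μ j = αc + βc j`,
`Σ_{R ⊆ Rt} μ(k + #(Rt∖R)) e(R) e(Rt∖R) = (αc + βc k + βc #Rt/2) e₂(Rt)`. [folklore] -/
theorem collapse_ee (he₂ : ∀ Z, ∑ R ∈ Z.powerset, e R * e (Z \ R) = e₂ Z) (hμ : ∀ j, μ j = αc + βc * j)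
    (Rt : Finset α) (k : ℕ) :
    ∑ R ∈ Rt.powerset, μ (k + #(Rt \ R)) * (e R * e (Rt \ R)) = (αc + βc * k + βc * #Rt / 2) * e₂ Rt := by
  have hexp : ∀ R ∈ Rt.powerset, μ (k + #(Rt \ R)) * (e R * e (Rt \ R)) =
      (αc + βc * k) * (e R * e (Rt \ R)) + βc * ((#(Rt \ R) : ℝ) * (e R * e (Rt \ R))) := by
    intro R _; rw [hμ]; push_cast; ring
  rw [sum_congr rfl hexp, sum_add_distrib, ← mul_sum, ← mul_sum, he₂]
  have h2 := two_mul_sum_card_sdiff_mul e Rt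
  rw [he₂] at h2
  have h3 : ∑ R ∈ Rt.powerset, ((#(Rt \ R) : ℝ) * (e R * e (Rt \ R))) = (#Rt : ℝ) * e₂ Rt / 2 := by linarith
  rw [h3]; ring

/-- **Affine collapse, shape `(e, ν)`** with `ν = ub ⋆ e` on the second side:
`Σ_{R ⊆ Rt} μ(k + #(Rt∖R)) e(R) ν(Rt∖R) = Σ_{Z ⊆ Rt} ub(Z) (αc + βc k + βc (#Rt + #Z)/2) e₂(Rt∖Z)`. [folklore] -/
theorem collapse_eν (he₂ : ∀ Z, ∑ R ∈ Z.powerset, e R * e (Z \ R) = e₂ Z) (hμ : ∀ j, μ j = αc + βc * j)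
    (Rt : Finset α) (k : ℕ) :
    ∑ R ∈ Rt.powerset, μ (k + #(Rt \ R)) * (e R * spConv ub e (Rt \ R)) =
      ∑ Z ∈ Rt.powerset, ub Z * ((αc + βc * k + βc * (#Rt + #Z) / 2) * e₂ (Rt \ Z)) := by
  -- expand `ν` and exchange the sums
  have h1 : ∑ R ∈ Rt.powerset, μ (k + #(Rt \ R)) * (e R * spConv ub e (Rt \ R)) =
      ∑ R ∈ Rt.powerset, ∑ Z ∈ (Rt \ R).powerset, μ (k + #(Rt \ R)) * e R * ub Z * e ((Rt \ R) \ Z) := by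
    refine sum_congr rfl fun R _ => ?_
    rw [spConv_apply, mul_sum, mul_sum]
    exact sum_congr rfl fun Z _ => by ring
  rw [h1, sum_powerset_sdiff_comm Rt]
  refine sum_congr rfl fun Z hZ => ?_
  have hZ' := mem_powerset.1 hZ
  have hcard : ∀ R ∈ (Rt \ Z).powerset, #(Rt \ R) = #Z + #((Rt \ Z) \ R) := by
    intro R hR
    have hRZ : Disjoint R Z := disjoint_of_subset_left (mem_powerset.1 hR) sdiff_disjoint
    have hset : Rt \ R = Z ∪ ((Rt \ Z) \ R) := by
      ext v; simp only [Finset.mem_sdiff, mem_union]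
      constructor
      · rintro ⟨hv, hvR⟩; by_cases hvZ : v ∈ Z
        · exact Or.inl hvZ
        · exact Or.inr ⟨⟨hv, hvZ⟩, hvR⟩
      · rintro (hvZ | ⟨⟨hv, -⟩, hvR⟩)
        · exact ⟨hZ' hvZ, fun hvR => disjoint_left.1 hRZ hvR hvZ⟩
        · exact ⟨hv, hvR⟩
    rw [hset, card_union_of_disjoint (disjoint_of_subset_right sdiff_subset sdiff_disjoint.symm)]
  have hexp : ∀ R ∈ (Rt \ Z).powerset, μ (k + #(Rt \ R)) * e R * ub Z * e ((Rt \ R) \ Z) =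
      ub Z * (μ ((k + #Z) + #((Rt \ Z) \ R)) * (e R * e ((Rt \ Z) \ R))) := by
    intro R hR
    rw [hcard R hR, sdiff_right_comm, add_assoc]; ring
  rw [sum_congr rfl hexp, ← mul_sum, collapse_ee e e₂ μ αc βc he₂ hμ (Rt \ Z) (k + #Z)]
  congr 1
  rw [card_sdiff_of_subset hZ', Nat.cast_sub (card_le_card hZ')]
  push_cast
  ring

/-- **Affine collapse, shape `(ν, e)`** with `ν = ub ⋆ e` on the first side:
`Σ_{R ⊆ Rt} μ(k + #(Rt∖R)) ν(R) e(Rt∖R) = Σ_{Z ⊆ Rt} ub(Z) (αc + βc k + βc (#Rt - #Z)/2) e₂(Rt∖Z)`. [folklore] -/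
theorem collapse_νe (he₂ : ∀ Z, ∑ R ∈ Z.powerset, e R * e (Z \ R) = e₂ Z) (hμ : ∀ j, μ j = αc + βc * j)
    (Rt : Finset α) (k : ℕ) :
    ∑ R ∈ Rt.powerset, μ (k + #(Rt \ R)) * (spConv ub e R * e (Rt \ R)) =
      ∑ Z ∈ Rt.powerset, ub Z * ((αc + βc * k + βc * (#Rt - #Z) / 2) * e₂ (Rt \ Z)) := by
  have h1 : ∑ R ∈ Rt.powerset, μ (k + #(Rt \ R)) * (spConv ub e R * e (Rt \ R)) =
      ∑ R ∈ Rt.powerset, ∑ Z ∈ R.powerset,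
        (fun Z R' => μ (k + #(Rt \ (Z ∪ R'))) * ub Z * e R' * e (Rt \ (Z ∪ R'))) Z (R \ Z) := by
    refine sum_congr rfl fun R hR => ?_
    rw [spConv_apply, sum_mul, mul_sum]
    refine sum_congr rfl fun Z hZ => ?_
    show _ = μ (k + #(Rt \ (Z ∪ (R \ Z)))) * ub Z * e (R \ Z) * e (Rt \ (Z ∪ (R \ Z)))
    rw [union_sdiff_of_subset (mem_powerset.1 hZ)]; ring
  rw [h1, sum_powerset_powerset_eq Rt (fun Z R' => μ (k + #(Rt \ (Z ∪ R'))) * ub Z * e R' * e (Rt \ (Z ∪ R')))]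
  refine sum_congr rfl fun Z hZ => ?_
  have hZ' := mem_powerset.1 hZ
  have hexp : ∀ R' ∈ (Rt \ Z).powerset,
      (fun Z R' => μ (k + #(Rt \ (Z ∪ R'))) * ub Z * e R' * e (Rt \ (Z ∪ R'))) Z R' =
      ub Z * (μ (k + #((Rt \ Z) \ R')) * (e R' * e ((Rt \ Z) \ R'))) := by
    intro R' _
    show μ (k + #(Rt \ (Z ∪ R'))) * ub Z * e R' * e (Rt \ (Z ∪ R')) = _
    have hset : (Rt \ Z) \ R' = Rt \ (Z ∪ R') := by rw [sdiff_sdiff_left, sup_eq_union]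
    rw [hset]; ring
  rw [sum_congr rfl hexp, ← mul_sum, collapse_ee e e₂ μ αc βc he₂ hμ (Rt \ Z) k]
  congr 1
  rw [card_sdiff_of_subset hZ', Nat.cast_sub (card_le_card hZ')]

/-- **The weighted diagonal of a sum of atoms**, reindexed by the footprint (`sum_powerset_split₄`). [folklore] -/
theorem diag_collapse (φ : Finset α → Finset α → ℝ) (ψ₁ ψ₂ : Finset α → ℝ) (μ : ℕ → ℝ) (X : Finset α) :
    ∑ U ∈ X.powerset, μ #(X \ U) * ∑ S ∈ U.powerset, ∑ E ∈ (X \ U).powerset, φ S E * ψ₁ (U \ S) * ψ₂ ((X \ U) \ E) =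
      ∑ T ∈ X.powerset, ∑ E ∈ T.powerset, φ (T \ E) E *
        ∑ R ∈ (X \ T).powerset, μ (#E + #((X \ T) \ R)) * (ψ₁ R * ψ₂ ((X \ T) \ R)) := by
  have h1 : ∀ U ∈ X.powerset, μ #(X \ U) * ∑ S ∈ U.powerset, ∑ E ∈ (X \ U).powerset, φ S E * ψ₁ (U \ S) * ψ₂ ((X \ U) \ E) =
      ∑ S ∈ U.powerset, ∑ E ∈ (X \ U).powerset,
        (fun S E R₁ R₂ => φ S E * (μ (#E + #R₂) * (ψ₁ R₁ * ψ₂ R₂))) S E (U \ S) ((X \ U) \ E) := by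
    intro U _
    rw [mul_sum]
    refine sum_congr rfl fun S _ => ?_
    rw [mul_sum]
    refine sum_congr rfl fun E hE => ?_
    show _ = φ S E * (μ (#E + #((X \ U) \ E)) * (ψ₁ (U \ S) * ψ₂ ((X \ U) \ E)))
    rw [add_comm #E, card_sdiff_add_card_eq_card (mem_powerset.1 hE)]; ring
  rw [sum_congr rfl h1, sum_powerset_split₄ X (fun S E R₁ R₂ => φ S E * (μ (#E + #R₂) * (ψ₁ R₁ * ψ₂ R₂)))]
  refine sum_congr rfl fun T _ => sum_congr rfl fun E _ => ?_
  rw [mul_sum]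

/-- Type I parity sum: `Σ_{E ⊆ T} 𝟙[#E even] (2#E - #T) = -𝟙[#T = 1]`. [folklore] -/
theorem sum_powerset_ite_even_two_mul_card_sub (T : Finset α) :
    ∑ E ∈ T.powerset, (if Even #E then (2 * (#E : ℝ) - #T) else 0) = -(if #T = 1 then 1 else 0) := by
  rw [← sum_filter_even_card_sub_two_mul_card, sum_filter, ← sum_neg_distrib]
  refine sum_congr rfl fun E _ => ?_
  split_ifs <;> ring

/-- Type II parity sum: `Σ_{E ⊆ T} (𝟙[#E odd] - 𝟙[#E even]) (c + 2#E) = 2·𝟙[#T = 1] - c·𝟙[T = ∅]`. [folklore] -/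
theorem sum_powerset_ite_parity_affine (T : Finset α) (c : ℝ) :
    ∑ E ∈ T.powerset, ((if Even #E then -1 else 1) * (c + 2 * #E)) =
      2 * (if #T = 1 then 1 else 0) - c * (if T = ∅ then 1 else 0) := by
  have h := sum_powerset_neg_one_pow_affine T c 2
  have h' : ∑ E ∈ T.powerset, ((if Even #E then -1 else 1) * (c + 2 * #E)) =
      -∑ E ∈ T.powerset, (-1 : ℝ) ^ #E * (c + 2 * #E) := by
    rw [← sum_neg_distrib]
    refine sum_congr rfl fun E _ => ?_
    by_cases he : Even #E
    · rw [if_pos he, he.neg_one_pow]; ring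
    · rw [if_neg he, (Nat.not_even_iff_odd.1 he).neg_one_pow]; ring
  rw [h', h]; ring

/-- Type III parity sum: `Σ_{E ⊆ T} 𝟙[#E odd] (4#E - 2#T) = 2·𝟙[#T = 1]`. [folklore] -/
theorem sum_powerset_ite_odd_four_mul_card_sub (T : Finset α) :
    ∑ E ∈ T.powerset, (if Even #E then 0 else (4 * (#E : ℝ) - 2 * #T)) = 2 * (if #T = 1 then 1 else 0) := by
  have h := sum_filter_odd_card_sub_two_mul_card T
  rw [sum_filter] at h
  have h' : ∑ E ∈ T.powerset, (if Even #E then 0 else (4 * (#E : ℝ) - 2 * #T)) =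
      -2 * ∑ E ∈ T.powerset, (if ¬ Even #E then ((#T : ℝ) - 2 * #E) else 0) := by
    rw [mul_sum]
    refine sum_congr rfl fun E _ => ?_
    by_cases he : Even #E
    · rw [if_pos he, if_neg (not_not.2 he)]; ring
    · rw [if_neg he, if_pos he]; ring
  rw [h', h]; ring

end Generic

variable {V : Type*} [Fintype V] [DecidableEq V] {G : SimpleGraph V} [DecidableRel G.Adj]

namespace Current

variable {K : G.edgeFinset → ℝ}

/-! ### Small model facts -/

/-- `ν²_{A,b}(R) = Σ_{Z ⊆ R} u_A(Z + b) e_A^{(2)}(R ∖ Z)`. [cite: Shlosman1986, §2] -/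
def nu2 (K : G.edgeFinset → ℝ) (A : Finset V) (b : V) (R : Finset V) : ℝ :=
  ∑ Z ∈ R.powerset, uK (cutCoupling K A) (insert b Z) * eA K A 2 (R \ Z)

/-- The frozen-cluster mass does not depend on the choice of the root inside the cluster. [folklore] -/
theorem jmass_root (K : G.edgeFinset → ℝ) {u u' : V} {A : Finset V} (hu : u ∈ A) (hu' : u' ∈ A) (S T : Finset V) :
    jmass K u A S T = jmass K u' A S T := by
  unfold jmass
  refine tsum_congr fun p => ?_
  congr 1
  by_cases h : (p.1 + p.2).cluster u = A
  · have h' : (p.1 + p.2).cluster u' = A := by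
      ext v
      rw [← h]
      have hu'c : u' ∈ (p.1 + p.2).cluster u := h ▸ hu'
      exact ⟨fun hv => mem_cluster_trans hu'c hv, fun hv => mem_cluster_trans (mem_cluster_comm.1 hu'c) hv⟩
    rw [if_pos h, if_pos h']
  · have h' : ¬ (p.1 + p.2).cluster u' = A := by
      intro h'
      apply h
      ext v
      rw [← h']
      have huc : u ∈ (p.1 + p.2).cluster u' := h' ▸ hu
      exact ⟨fun hv => mem_cluster_trans huc hv, fun hv => mem_cluster_trans (mem_cluster_comm.1 huc) hv⟩
    rw [if_neg h, if_neg h']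

/-- The cluster weight with both `a, b` among the sources is the same for the roots `a` and `b`. [folklore] -/
theorem cw_root {a b : V} (K : G.edgeFinset → ℝ) (A : Finset V) {B : Finset V} (ha : a ∈ B) (hb : b ∈ B) :
    cw K a A B = cw K b A B := by
  unfold cw
  split_ifs with h
  · unfold rhoI; rw [jmass_root K (h ha) (h hb)]
  · rfl

/-- `cw_A(B) = 0` for `#B` odd (no current has an odd source set). [folklore] -/
theorem cw_eq_zero_of_odd (K : G.edgeFinset → ℝ) (u : V) (A : Finset V) {B : Finset V} (hB : Odd #B) : cw K u A B = 0 := by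
  unfold cw rhoI
  split_ifs with h
  · unfold jmass epairWeight
    have : (∑' p : Current G × Current G, (if p.1.sources = B ∧ p.2.sources = ∅ then p.1.eweight K * p.2.eweight K else 0) *
        (if (p.1 + p.2).cluster u = A then 1 else 0)) = 0 := by
      refine ENNReal.tsum_eq_zero.2 fun p => ?_
      rw [if_neg, zero_mul]
      rintro ⟨h1, -⟩
      exact (Nat.not_even_iff_odd.2 hB) (h1 ▸ even_card_sources p.1)
    rw [this]; simp
  · rfl

/-- `D_{ab} = D_{ba}`. [folklore] -/
theorem Dab_comm (K : G.edgeFinset → ℝ) (a b : V) (Y : Finset V) : Dab K a b Y = Dab K b a Y := by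
  unfold Dab
  rw [Finset.insert_comm]
  congr 1
  refine sum_nbij' (fun S => Y \ S) (fun S => Y \ S) ?_ ?_ ?_ ?_ ?_
  · intro S _; exact mem_powerset.2 sdiff_subset
  · intro S _; exact mem_powerset.2 sdiff_subset
  · intro S hS; exact Finset.sdiff_sdiff_eq_self (mem_powerset.1 hS)
  · intro S hS; exact Finset.sdiff_sdiff_eq_self (mem_powerset.1 hS)
  · intro S hS; rw [Finset.sdiff_sdiff_eq_self (mem_powerset.1 hS), mul_comm]

/-- `Σ_{R ⊆ Z} e_A(R) e_A(Z ∖ R) = e_A^{(2)}(Z)` in the form used by the collapses. [folklore] -/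
theorem eA_conv_self (K : G.edgeFinset → ℝ) (A : Finset V) : ∀ Z : Finset V,
    ∑ R ∈ Z.powerset, eA K A 1 R * eA K A 1 (Z \ R) = eA K A 2 Z := sum_powerset_eA_mul_eA K A

/-! ### Weighted diagonals of the six atom families -/

section Diagonals

variable (μ : ℕ → ℝ) (αc βc : ℝ) (hμ : ∀ j, μ j = αc + βc * j)
include hμ

/-- Weighted diagonal of the atoms `atomC1e`. [folklore] -/
theorem dcollapse_C1e (K : G.edgeFinset → ℝ) (a b : V) (A X : Finset V) :
    ∑ U ∈ X.powerset, μ #(X \ U) * atomC1e K a b A U (X \ U) =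
      ∑ T ∈ X.powerset, ∑ E ∈ T.powerset, (if Even #E then cw K a A (insert a (insert b T)) else 0) *
        ((αc + βc * #E + βc * #(X \ T) / 2) * eA K A 2 (X \ T)) := by
  unfold atomC1e
  rw [diag_collapse]
  refine sum_congr rfl fun T _ => sum_congr rfl fun E hE => ?_
  rw [sdiff_union_of_subset (mem_powerset.1 hE), collapse_ee _ _ μ αc βc (eA_conv_self K A) hμ]

/-- Weighted diagonal of the atoms `atomC1o`. [folklore] -/
theorem dcollapse_C1o (K : G.edgeFinset → ℝ) (a b : V) (A X : Finset V) :
    ∑ U ∈ X.powerset, μ #(X \ U) * atomC1o K a b A U (X \ U) =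
      ∑ T ∈ X.powerset, ∑ E ∈ T.powerset, (if Even #E then 0 else cw K a A (insert a T)) *
        ∑ Z ∈ (X \ T).powerset, uK (cutCoupling K A) (insert b Z) *
          ((αc + βc * #E + βc * (#(X \ T) + #Z) / 2) * eA K A 2 ((X \ T) \ Z)) := by
  unfold atomC1o nuA
  rw [diag_collapse]
  refine sum_congr rfl fun T _ => sum_congr rfl fun E hE => ?_
  rw [sdiff_union_of_subset (mem_powerset.1 hE), collapse_eν _ _ _ μ αc βc (eA_conv_self K A) hμ]

/-- Weighted diagonal of the atoms `atomC2ao`. [folklore] -/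
theorem dcollapse_C2ao (K : G.edgeFinset → ℝ) (a b : V) (A X : Finset V) :
    ∑ U ∈ X.powerset, μ #(X \ U) * atomC2ao K a b A U (X \ U) =
      ∑ T ∈ X.powerset, ∑ E ∈ T.powerset, (if Even #E then 0 else cw K a A (insert a (insert b T))) *
        ((αc + βc * #E + βc * #(X \ T) / 2) * eA K A 2 (X \ T)) := by
  unfold atomC2ao
  rw [diag_collapse]
  refine sum_congr rfl fun T _ => sum_congr rfl fun E hE => ?_
  rw [sdiff_union_of_subset (mem_powerset.1 hE), collapse_ee _ _ μ αc βc (eA_conv_self K A) hμ]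

/-- Weighted diagonal of the atoms `atomC2ae`. [folklore] -/
theorem dcollapse_C2ae (K : G.edgeFinset → ℝ) (a b : V) (A X : Finset V) :
    ∑ U ∈ X.powerset, μ #(X \ U) * atomC2ae K a b A U (X \ U) =
      ∑ T ∈ X.powerset, ∑ E ∈ T.powerset, (if Even #E then cw K a A (insert a T) else 0) *
        ∑ Z ∈ (X \ T).powerset, uK (cutCoupling K A) (insert b Z) *
          ((αc + βc * #E + βc * (#(X \ T) + #Z) / 2) * eA K A 2 ((X \ T) \ Z)) := by
  unfold atomC2ae nuA
  rw [diag_collapse]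
  refine sum_congr rfl fun T _ => sum_congr rfl fun E hE => ?_
  rw [sdiff_union_of_subset (mem_powerset.1 hE), collapse_eν _ _ _ μ αc βc (eA_conv_self K A) hμ]

/-- Weighted diagonal of the atoms `atomC2bo`. [folklore] -/
theorem dcollapse_C2bo (K : G.edgeFinset → ℝ) (a b : V) (A X : Finset V) :
    ∑ U ∈ X.powerset, μ #(X \ U) * atomC2bo K a b A U (X \ U) =
      ∑ T ∈ X.powerset, ∑ E ∈ T.powerset, (if Even #E then 0 else cw K b A (insert a (insert b T))) *
        ((αc + βc * #E + βc * #(X \ T) / 2) * eA K A 2 (X \ T)) := by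
  unfold atomC2bo
  rw [diag_collapse]
  refine sum_congr rfl fun T _ => sum_congr rfl fun E hE => ?_
  rw [sdiff_union_of_subset (mem_powerset.1 hE), collapse_ee _ _ μ αc βc (eA_conv_self K A) hμ]

/-- Weighted diagonal of the atoms `atomC2ba`. [folklore] -/
theorem dcollapse_C2ba (K : G.edgeFinset → ℝ) (a b : V) (A X : Finset V) :
    ∑ U ∈ X.powerset, μ #(X \ U) * atomC2ba K a b A U (X \ U) =
      ∑ T ∈ X.powerset, ∑ E ∈ T.powerset, (if Even #E then 0 else cw K b A (insert b T)) *
        ∑ Z ∈ (X \ T).powerset, uK (cutCoupling K A) (insert a Z) *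
          ((αc + βc * #E + βc * (#(X \ T) - #Z) / 2) * eA K A 2 ((X \ T) \ Z)) := by
  unfold atomC2ba nuA
  rw [diag_collapse]
  refine sum_congr rfl fun T _ => sum_congr rfl fun E hE => ?_
  rw [sdiff_union_of_subset (mem_powerset.1 hE), collapse_νe _ _ _ μ αc βc (eA_conv_self K A) hμ]

end Diagonals

/-! ### Evaluation of the family right-hand sides -/

/-- Evaluation of `famC1Rhs`. [folklore] -/
theorem famC1Rhs_apply (K : G.edgeFinset → ℝ) (a b : V) (U U' : Finset V) :
    famC1Rhs K a b U U' = ∑ A : Finset V, (atomC1e K a b A U U' + atomC1o K a b A U U') := by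
  simp only [famC1Rhs, Finset.sum_apply, Pi.add_apply]

/-- Evaluation of `famC2aRhs`. [folklore] -/
theorem famC2aRhs_apply (K : G.edgeFinset → ℝ) (a b : V) (U U' : Finset V) :
    famC2aRhs K a b U U' = ∑ A : Finset V, (atomC2ao K a b A U U' + atomC2ae K a b A U U') := by
  simp only [famC2aRhs, Finset.sum_apply, Pi.add_apply]

/-- Evaluation of `famC2bRhs`. [folklore] -/
theorem famC2bRhs_apply (K : G.edgeFinset → ℝ) (a b : V) (U U' : Finset V) :
    famC2bRhs K a b U U' = ∑ A : Finset V, (atomC2bo K a b A U U' + atomC2ba K a b A U U') := by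
  simp only [famC2bRhs, Finset.sum_apply, Pi.add_apply]

/-! ### The master identity for `D_{ab}` -/

/-- **Master identity C** (evidence "full_proof.md", Thm C): for `#X = 2m` and `a ≠ b` off `X`,
`2m · D_{ab}(X) = Σ_{x ∈ X} Σ_A ( cw_A^{(a)}({a,x}) ν²_{A,b}(X∖x) + cw_A^{(b)}({b,x}) ν²_{A,a}(X∖x) )`.
Proof: the affine diagonal collapse of `(2#U'-2m)(familyC1@a + familyC1@b) + (2m-2#U')(familyC2a - familyC2b)`.
[cite: CamiaJiangNewman2023, Theorem 1.1] -/
theorem masterC (hK : ∀ e, 0 ≤ K e) {a b : V} (hab : a ≠ b) {X : Finset V} (haX : a ∉ X) (hbX : b ∉ X)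
    {m : ℕ} (hX : #X = 2 * m) :
    (2 * m : ℝ) * Dab K a b X =
      ∑ x ∈ X, ∑ A : Finset V, (cw K a A {a, x} * nu2 K A b (X.erase x) + cw K b A {b, x} * nu2 K A a (X.erase x)) := by
  -- the two affine multipliers
  set μ₁ : ℕ → ℝ := fun j => -(#X : ℝ) + 2 * j with hμ₁
  set μ₂ : ℕ → ℝ := fun j => (#X : ℝ) + (-2) * j with hμ₂
  have hμ₁' : ∀ j, μ₁ j = -(#X : ℝ) + 2 * j := fun j => rfl
  have hμ₂' : ∀ j, μ₂ j = (#X : ℝ) + (-2) * j := fun j => rfl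
  -- (S1) the weighted sum of the four family identities over all splittings
  have hsplit : ∀ U ∈ X.powerset,
      (μ₁ #(X \ U) * (if U = ∅ then Dab K a b (X \ U) else 0) + μ₁ #(X \ U) * (if U = ∅ then Dab K b a (X \ U) else 0)
        + (μ₂ #(X \ U) * (uK K (insert a U) * uK K (insert b (X \ U))) -
          μ₂ #(X \ U) * (uK K (insert a U) * uK K (insert b (X \ U))))) =
      μ₁ #(X \ U) * famC1Rhs K a b U (X \ U) + μ₁ #(X \ U) * famC1Rhs K b a U (X \ U)
        + (μ₂ #(X \ U) * famC2aRhs K a b U (X \ U) - μ₂ #(X \ U) * famC2bRhs K a b U (X \ U)) := by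
    intro U hU
    have hUX := mem_powerset.1 hU
    have haU : a ∉ U := fun h => haX (hUX h)
    have hbU : b ∉ U := fun h => hbX (hUX h)
    have haU' : a ∉ X \ U := fun h => haX (sdiff_subset h)
    have hbU' : b ∉ X \ U := fun h => hbX (sdiff_subset h)
    have e1 := familyC1 hK hab haU hbU haU' hbU' disjoint_sdiff
    have e2 := familyC1 hK hab.symm hbU haU hbU' haU' disjoint_sdiff
    have e3 := familyC2a hK hab haU hbU haU' hbU' disjoint_sdiff
    have e4 := familyC2b hK hab haU hbU haU' hbU' disjoint_sdiff
    rw [← e1, ← e2, ← e3, ← e4]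
  have hsum := sum_congr rfl hsplit
  -- the left-hand side is `2 #X · D_{ab}(X)`
  have hL : ∑ U ∈ X.powerset,
      (μ₁ #(X \ U) * (if U = ∅ then Dab K a b (X \ U) else 0) + μ₁ #(X \ U) * (if U = ∅ then Dab K b a (X \ U) else 0)
        + (μ₂ #(X \ U) * (uK K (insert a U) * uK K (insert b (X \ U))) -
          μ₂ #(X \ U) * (uK K (insert a U) * uK K (insert b (X \ U))))) = 2 * ((#X : ℝ) * Dab K a b X) := by
    have hterm : ∀ U ∈ X.powerset,
        (μ₁ #(X \ U) * (if U = ∅ then Dab K a b (X \ U) else 0) + μ₁ #(X \ U) * (if U = ∅ then Dab K b a (X \ U) else 0)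
          + (μ₂ #(X \ U) * (uK K (insert a U) * uK K (insert b (X \ U))) -
            μ₂ #(X \ U) * (uK K (insert a U) * uK K (insert b (X \ U))))) =
        if U = ∅ then 2 * (μ₁ #(X \ U) * Dab K a b (X \ U)) else 0 := by
      intro U _
      rw [← Dab_comm K a b]
      split_ifs <;> ring
    rw [sum_congr rfl hterm, sum_eq_single_of_mem ∅ (empty_mem_powerset X) (fun U _ hU => if_neg hU), if_pos rfl,
      sdiff_empty, hμ₁']
    ring
  rw [hL] at hsum
  -- (S2) the right-hand side: expand the families into atoms and exchange the sums
  have hR : ∑ U ∈ X.powerset, (μ₁ #(X \ U) * famC1Rhs K a b U (X \ U) + μ₁ #(X \ U) * famC1Rhs K b a U (X \ U)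
        + (μ₂ #(X \ U) * famC2aRhs K a b U (X \ U) - μ₂ #(X \ U) * famC2bRhs K a b U (X \ U))) =
      ∑ A : Finset V, ∑ U ∈ X.powerset,
        (μ₁ #(X \ U) * atomC1e K a b A U (X \ U) + μ₁ #(X \ U) * atomC1o K a b A U (X \ U)
          + (μ₁ #(X \ U) * atomC1e K b a A U (X \ U) + μ₁ #(X \ U) * atomC1o K b a A U (X \ U))
          + (μ₂ #(X \ U) * atomC2ao K a b A U (X \ U) + μ₂ #(X \ U) * atomC2ae K a b A U (X \ U))
          - (μ₂ #(X \ U) * atomC2bo K a b A U (X \ U) + μ₂ #(X \ U) * atomC2ba K a b A U (X \ U))) := by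
    rw [sum_comm]
    refine sum_congr rfl fun U _ => ?_
    rw [famC1Rhs_apply, famC1Rhs_apply, famC2aRhs_apply, famC2bRhs_apply, mul_sum, mul_sum, mul_sum, mul_sum,
      ← sum_add_distrib, ← sum_sub_distrib, ← sum_add_distrib]
    refine sum_congr rfl fun A _ => ?_
    ring
  rw [hR] at hsum
  -- (S3) cluster by cluster
  have hA : ∀ A : Finset V, ∑ U ∈ X.powerset,
        (μ₁ #(X \ U) * atomC1e K a b A U (X \ U) + μ₁ #(X \ U) * atomC1o K a b A U (X \ U)
          + (μ₁ #(X \ U) * atomC1e K b a A U (X \ U) + μ₁ #(X \ U) * atomC1o K b a A U (X \ U))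
          + (μ₂ #(X \ U) * atomC2ao K a b A U (X \ U) + μ₂ #(X \ U) * atomC2ae K a b A U (X \ U))
          - (μ₂ #(X \ U) * atomC2bo K a b A U (X \ U) + μ₂ #(X \ U) * atomC2ba K a b A U (X \ U))) =
      2 * ∑ x ∈ X, (cw K a A {a, x} * nu2 K A b (X.erase x) + cw K b A {b, x} * nu2 K A a (X.erase x)) := by
    intro A
    rw [sum_sub_distrib, sum_add_distrib, sum_add_distrib, sum_add_distrib, sum_add_distrib, sum_add_distrib,
      sum_add_distrib,
      dcollapse_C1e μ₁ _ _ hμ₁' K a b A X, dcollapse_C1o μ₁ _ _ hμ₁' K a b A X,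
      dcollapse_C1e μ₁ _ _ hμ₁' K b a A X, dcollapse_C1o μ₁ _ _ hμ₁' K b a A X,
      dcollapse_C2ao μ₂ _ _ hμ₂' K a b A X, dcollapse_C2ae μ₂ _ _ hμ₂' K a b A X,
      dcollapse_C2bo μ₂ _ _ hμ₂' K a b A X, dcollapse_C2ba μ₂ _ _ hμ₂' K a b A X]
    -- Type I: both `a, b` among the sources — cancels
    have hI : ∀ T ∈ X.powerset,
        ∑ E ∈ T.powerset, (if Even #E then cw K a A (insert a (insert b T)) else 0) *
            ((-(#X : ℝ) + 2 * #E + 2 * #(X \ T) / 2) * eA K A 2 (X \ T))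
        + ∑ E ∈ T.powerset, (if Even #E then cw K b A (insert b (insert a T)) else 0) *
            ((-(#X : ℝ) + 2 * #E + 2 * #(X \ T) / 2) * eA K A 2 (X \ T))
        + ∑ E ∈ T.powerset, (if Even #E then 0 else cw K a A (insert a (insert b T))) *
            (((#X : ℝ) + (-2) * #E + (-2) * #(X \ T) / 2) * eA K A 2 (X \ T))
        - ∑ E ∈ T.powerset, (if Even #E then 0 else cw K b A (insert a (insert b T))) *
            (((#X : ℝ) + (-2) * #E + (-2) * #(X \ T) / 2) * eA K A 2 (X \ T)) = 0 := by
      intro T hT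
      have hTX := mem_powerset.1 hT
      have hcw1 : cw K b A (insert b (insert a T)) = cw K a A (insert a (insert b T)) := by
        rw [Finset.insert_comm]
        exact (cw_root K A (mem_insert_self a _) (mem_insert_of_mem (mem_insert_self b T))).symm
      have hcw2 : cw K b A (insert a (insert b T)) = cw K a A (insert a (insert b T)) :=
        (cw_root K A (mem_insert_self a _) (mem_insert_of_mem (mem_insert_self b T))).symm
      simp only [hcw1, hcw2]
      rw [← sum_add_distrib, ← sum_add_distrib, ← sum_sub_distrib]
      have hE : ∀ E ∈ T.powerset,
          (if Even #E then cw K a A (insert a (insert b T)) else 0) * ((-(#X : ℝ) + 2 * #E + 2 * #(X \ T) / 2) * eA K A 2 (X \ T))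
          + (if Even #E then cw K a A (insert a (insert b T)) else 0) * ((-(#X : ℝ) + 2 * #E + 2 * #(X \ T) / 2) * eA K A 2 (X \ T))
          + (if Even #E then 0 else cw K a A (insert a (insert b T))) * (((#X : ℝ) + (-2) * #E + (-2) * #(X \ T) / 2) * eA K A 2 (X \ T))
          - (if Even #E then 0 else cw K a A (insert a (insert b T))) * (((#X : ℝ) + (-2) * #E + (-2) * #(X \ T) / 2) * eA K A 2 (X \ T)) =
          (2 * (cw K a A (insert a (insert b T)) * eA K A 2 (X \ T))) * (if Even #E then (2 * (#E : ℝ) - #T) else 0) := by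
        intro E _
        rw [card_sdiff_of_subset hTX, Nat.cast_sub (card_le_card hTX)]
        split_ifs <;> ring
      rw [sum_congr rfl hE, ← mul_sum, sum_powerset_ite_even_two_mul_card_sub]
      by_cases h1 : #T = 1
      · obtain ⟨x, rfl⟩ := card_eq_one.1 h1
        have hodd : Odd #(insert a (insert b {x})) := by
          rw [card_insert_of_notMem, card_insert_of_notMem, card_singleton]
          · decide
          · exact fun h => hbX (hTX (mem_singleton.1 h ▸ mem_singleton_self x))
          · simp only [mem_insert, mem_singleton, not_or]
            exact ⟨hab, fun h => haX (hTX (h ▸ mem_singleton_self x))⟩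
        rw [cw_eq_zero_of_odd K a A hodd]; ring
      · rw [if_neg h1]; ring
    -- Type II: root `a`, sources `T + a`, a `b`-block on the far side
    have hII : ∀ T ∈ X.powerset,
        ∑ E ∈ T.powerset, (if Even #E then 0 else cw K a A (insert a T)) *
            ∑ Z ∈ (X \ T).powerset, uK (cutCoupling K A) (insert b Z) *
              ((-(#X : ℝ) + 2 * #E + 2 * (#(X \ T) + #Z) / 2) * eA K A 2 ((X \ T) \ Z))
        + ∑ E ∈ T.powerset, (if Even #E then cw K a A (insert a T) else 0) *
            ∑ Z ∈ (X \ T).powerset, uK (cutCoupling K A) (insert b Z) *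
              (((#X : ℝ) + (-2) * #E + (-2) * (#(X \ T) + #Z) / 2) * eA K A 2 ((X \ T) \ Z)) =
        (if #T = 1 then 1 else 0) * (2 * (cw K a A (insert a T) * nu2 K A b (X \ T))) := by
      intro T hT
      have hTX := mem_powerset.1 hT
      -- exchange the `E`- and `Z`-sums
      rw [← sum_add_distrib]
      have hE : ∀ E ∈ T.powerset,
          (if Even #E then 0 else cw K a A (insert a T)) *
              ∑ Z ∈ (X \ T).powerset, uK (cutCoupling K A) (insert b Z) *
                ((-(#X : ℝ) + 2 * #E + 2 * (#(X \ T) + #Z) / 2) * eA K A 2 ((X \ T) \ Z))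
          + (if Even #E then cw K a A (insert a T) else 0) *
              ∑ Z ∈ (X \ T).powerset, uK (cutCoupling K A) (insert b Z) *
                (((#X : ℝ) + (-2) * #E + (-2) * (#(X \ T) + #Z) / 2) * eA K A 2 ((X \ T) \ Z)) =
          ∑ Z ∈ (X \ T).powerset, cw K a A (insert a T) * (uK (cutCoupling K A) (insert b Z) * eA K A 2 ((X \ T) \ Z)) *
            ((if Even #E then -1 else 1) * (((#Z : ℝ) - #T) + 2 * #E)) := by
        intro E _
        rw [mul_sum, mul_sum, ← sum_add_distrib]
        refine sum_congr rfl fun Z _ => ?_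
        rw [card_sdiff_of_subset hTX, Nat.cast_sub (card_le_card hTX)]
        split_ifs <;> ring
      rw [sum_congr rfl hE, sum_comm]
      have hZ : ∀ Z ∈ (X \ T).powerset,
          ∑ E ∈ T.powerset, cw K a A (insert a T) * (uK (cutCoupling K A) (insert b Z) * eA K A 2 ((X \ T) \ Z)) *
            ((if Even #E then -1 else 1) * (((#Z : ℝ) - #T) + 2 * #E)) =
          cw K a A (insert a T) * (uK (cutCoupling K A) (insert b Z) * eA K A 2 ((X \ T) \ Z)) *
            (2 * (if #T = 1 then 1 else 0) - ((#Z : ℝ) - #T) * (if T = ∅ then 1 else 0)) := by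
        intro Z _
        rw [← mul_sum, sum_powerset_ite_parity_affine]
      rw [sum_congr rfl hZ]
      by_cases hT0 : T = ∅
      · subst hT0
        have h0 : cw K a A {a} = 0 := cw_eq_zero_of_odd K a A (by rw [card_singleton]; exact ⟨0, rfl⟩)
        simp [h0]
      · simp only [if_neg hT0, mul_zero, sub_zero]
        rw [nu2, mul_sum, mul_sum, mul_sum]
        refine sum_congr rfl fun Z _ => ?_
        ring
    -- Type III: root `b`, sources `T + b`, an `a`-block on either side
    have hIII : ∀ T ∈ X.powerset,
        ∑ E ∈ T.powerset, (if Even #E then 0 else cw K b A (insert b T)) *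
            ∑ Z ∈ (X \ T).powerset, uK (cutCoupling K A) (insert a Z) *
              ((-(#X : ℝ) + 2 * #E + 2 * (#(X \ T) + #Z) / 2) * eA K A 2 ((X \ T) \ Z))
        - ∑ E ∈ T.powerset, (if Even #E then 0 else cw K b A (insert b T)) *
            ∑ Z ∈ (X \ T).powerset, uK (cutCoupling K A) (insert a Z) *
              (((#X : ℝ) + (-2) * #E + (-2) * (#(X \ T) - #Z) / 2) * eA K A 2 ((X \ T) \ Z)) =
        (if #T = 1 then 1 else 0) * (2 * (cw K b A (insert b T) * nu2 K A a (X \ T))) := by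
      intro T hT
      have hTX := mem_powerset.1 hT
      rw [← sum_sub_distrib]
      have hE : ∀ E ∈ T.powerset,
          (if Even #E then 0 else cw K b A (insert b T)) *
              ∑ Z ∈ (X \ T).powerset, uK (cutCoupling K A) (insert a Z) *
                ((-(#X : ℝ) + 2 * #E + 2 * (#(X \ T) + #Z) / 2) * eA K A 2 ((X \ T) \ Z))
          - (if Even #E then 0 else cw K b A (insert b T)) *
              ∑ Z ∈ (X \ T).powerset, uK (cutCoupling K A) (insert a Z) *
                (((#X : ℝ) + (-2) * #E + (-2) * (#(X \ T) - #Z) / 2) * eA K A 2 ((X \ T) \ Z)) =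
          (cw K b A (insert b T) * nu2 K A a (X \ T)) * (if Even #E then 0 else (4 * (#E : ℝ) - 2 * #T)) := by
        intro E _
        rw [mul_sum, mul_sum, ← sum_sub_distrib, nu2, mul_sum, sum_mul]
        refine sum_congr rfl fun Z _ => ?_
        rw [card_sdiff_of_subset hTX, Nat.cast_sub (card_le_card hTX)]
        split_ifs <;> ring
      rw [sum_congr rfl hE, ← mul_sum, sum_powerset_ite_odd_four_mul_card_sub]
      ring
    -- assemble the three types
    have hgroup : ∀ T ∈ X.powerset,
        ∑ E ∈ T.powerset, (if Even #E then cw K a A (insert a (insert b T)) else 0) *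
            ((-(#X : ℝ) + 2 * #E + 2 * #(X \ T) / 2) * eA K A 2 (X \ T))
        + ∑ E ∈ T.powerset, (if Even #E then 0 else cw K a A (insert a T)) *
            ∑ Z ∈ (X \ T).powerset, uK (cutCoupling K A) (insert b Z) *
              ((-(#X : ℝ) + 2 * #E + 2 * (#(X \ T) + #Z) / 2) * eA K A 2 ((X \ T) \ Z))
        + (∑ E ∈ T.powerset, (if Even #E then cw K b A (insert b (insert a T)) else 0) *
            ((-(#X : ℝ) + 2 * #E + 2 * #(X \ T) / 2) * eA K A 2 (X \ T))
          + ∑ E ∈ T.powerset, (if Even #E then 0 else cw K b A (insert b T)) *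
            ∑ Z ∈ (X \ T).powerset, uK (cutCoupling K A) (insert a Z) *
              ((-(#X : ℝ) + 2 * #E + 2 * (#(X \ T) + #Z) / 2) * eA K A 2 ((X \ T) \ Z)))
        + (∑ E ∈ T.powerset, (if Even #E then 0 else cw K a A (insert a (insert b T))) *
            (((#X : ℝ) + (-2) * #E + (-2) * #(X \ T) / 2) * eA K A 2 (X \ T))
          + ∑ E ∈ T.powerset, (if Even #E then cw K a A (insert a T) else 0) *
            ∑ Z ∈ (X \ T).powerset, uK (cutCoupling K A) (insert b Z) *
              (((#X : ℝ) + (-2) * #E + (-2) * (#(X \ T) + #Z) / 2) * eA K A 2 ((X \ T) \ Z)))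
        - (∑ E ∈ T.powerset, (if Even #E then 0 else cw K b A (insert a (insert b T))) *
            (((#X : ℝ) + (-2) * #E + (-2) * #(X \ T) / 2) * eA K A 2 (X \ T))
          + ∑ E ∈ T.powerset, (if Even #E then 0 else cw K b A (insert b T)) *
            ∑ Z ∈ (X \ T).powerset, uK (cutCoupling K A) (insert a Z) *
              (((#X : ℝ) + (-2) * #E + (-2) * (#(X \ T) - #Z) / 2) * eA K A 2 ((X \ T) \ Z))) =
        (if #T = 1 then 1 else 0) * (2 * (cw K a A (insert a T) * nu2 K A b (X \ T) + cw K b A (insert b T) * nu2 K A a (X \ T))) := by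
      intro T hT
      have h1 := hI T hT; have h2 := hII T hT; have h3 := hIII T hT
      linear_combination h1 + h2 + h3
    rw [← sum_add_distrib, ← sum_add_distrib, ← sum_add_distrib, ← sum_add_distrib, ← sum_add_distrib,
      ← sum_add_distrib, ← sum_sub_distrib, sum_congr rfl hgroup]
    have hone : ∑ T ∈ X.powerset, (if #T = 1 then 1 else 0) *
        (2 * (cw K a A (insert a T) * nu2 K A b (X \ T) + cw K b A (insert b T) * nu2 K A a (X \ T))) =
        ∑ T ∈ X.powerset, (if #T = 1 then
          2 * (cw K a A (insert a T) * nu2 K A b (X \ T) + cw K b A (insert b T) * nu2 K A a (X \ T)) else 0) :=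
      sum_congr rfl fun T _ => by split_ifs <;> ring
    rw [hone, sum_powerset_ite_card_eq_one, mul_sum]
    refine sum_congr rfl fun x _ => ?_
    rw [sdiff_singleton_eq_erase]
  rw [sum_congr rfl fun A _ => hA A, ← mul_sum, sum_comm] at hsum
  have h2 : (#X : ℝ) * Dab K a b X =
      ∑ x ∈ X, ∑ A : Finset V, (cw K a A {a, x} * nu2 K A b (X.erase x) + cw K b A {b, x} * nu2 K A a (X.erase x)) := by
    linarith
  rw [← h2, hX]
  push_cast
  ring

end Current

end Literature.Probability.LatticeModels

end

/-!
# Part 4 — the joint induction: `(-1)^{k-1} ∂u_{2k}/∂J_{uv} ≥ 0` and `(-1)^{k-1} u_{2k} ≥ 0` for all `k`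

Closes the named fact `CamiaJiangNewman2023_thm1` of `UrsellMonotonicity.lean` (`CamiaJiangNewman2023_thm1_holds`),
together with Shlosman's sign theorem (`PairIsing.ursell_sign`).

## The argument

The published proofs are not followed (the induction of Camia–Jiang–Newman §3 rests on their Prop. 2 / eq. (31),
which is false as printed — `UrsellMonotonicityGraphPartitions` — and Shlosman's Thm 3 induction hypothesis fails at
order 6); instead both statements are proved by a **joint strong induction on the order** driven by two exact
identities of the random-current cluster calculus:

* the sign recursion `Current.masterB`: `(2m-1) u(W) = Σ_x Σ_A cw_A({w₀,x}) e_A^{(2)}(…)`, and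
* the derivative master identity `Current.masterC`: `2m D_{ab}(X) = Σ_x Σ_A (cw ν² + cw ν²)`,

in which every cluster weight `cw ≥ 0` and every block factor is, up to the factor `2`, either `-δ_A u(V)` (sign
`(-1)^{#V/2}` by the induction hypothesis: Shlosman's sign if `V` meets `A`, monotonicity in the couplings — the
derivative statement at lower order, integrated one entry at a time — otherwise) or an Ursell function of the cut
model (sign by the induction hypothesis).  The analytic input is CJN eq. (20) in the form
`∂u(X)/∂J_{ab} = D_{ab}(X)` (`deriv_ursell_setCoupling_eq_Dab`: differentiate the block recursion
`⟨σ_{Y+v}⟩ = Σ_Z u(Z+v)⟨σ_{Y∖Z}⟩` and deconvolve), the random-current dictionary `⟨σ_B⟩ = Z[B]/Z[∅]`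
(`UrsellMonotonicityTwo`), and the clone reduction `CamiaJiangNewman2023_thm1_of_injective`.

## References

* F. Camia, J. Jiang, C. M. Newman, *Monotonicity of Ursell functions in the Ising model*, Comm. Math. Phys. 401
  (2023) 2459–2482, arXiv:2207.12247, Theorem 1 [CamiaJiangNewman2023].
* S. B. Shlosman, *Signs of the Ising model Ursell functions*, Comm. Math. Phys. 102 (1986) 679–686 [Shlosman1986].
* M. Aizenman, Comm. Math. Phys. 86 (1982) 1–48, §5 [AizenmanCMP1982].
-/

noncomputable section

open Finset Filter
open scoped symmDiff ENNReal

namespace Literature.Probability.LatticeModels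

/-! ### Generic complements: transport of `ursellOf`, the pair-derivative form of a moment function -/

section Generic

variable {α β : Type*} [DecidableEq α] [DecidableEq β] {C : Type*} [CommRing C]

/-- Block recursion of a moment function at a vertex: `m(Y+v) = Σ_{Z ⊆ Y} mᵀ(Z+v) m(Y∖Z)`. [folklore] -/
theorem sum_powerset_ursellOf_insert_mul (m : Finset α → C) (hm0 : m ∅ = 1) {v : α} {Y : Finset α} (hv : v ∉ Y) :
    ∑ Z ∈ Y.powerset, ursellOf m (insert v Z) * m (Y \ Z) = m (insert v Y) := by
  rw [← spExp_ursellOf m hm0 (insert v Y), spExp_insert (ursellOf m) hv]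
  exact sum_congr rfl fun Z _ => by rw [spExp_ursellOf m hm0]

/-- The pair-derivative form of a moment function: `D_{ab}(Y) = mᵀ(Y+a+b) + Σ_{S ⊆ Y} mᵀ(S+a) mᵀ((Y∖S)+b)`.
[cite: CamiaJiangNewman2023, §2 eq. (20)] -/
def DabOf (m : Finset α → C) (a b : α) (Y : Finset α) : C :=
  ursellOf m (insert a (insert b Y)) + ∑ S ∈ Y.powerset, ursellOf m (insert a S) * ursellOf m (insert b (Y \ S))

/-- `D_{ab} ⋆ m = m(· + a + b)` on sets avoiding `a ≠ b`. [cite: CamiaJiangNewman2023, §2 eq. (20)] -/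
theorem spConv_DabOf (m : Finset α → C) (hm0 : m ∅ = 1) {a b : α} (hab : a ≠ b) {Z' : Finset α} (ha : a ∉ Z')
    (hb : b ∉ Z') : spConv (DabOf m a b) m Z' = m (insert a (insert b Z')) := by
  have hsplit : DabOf m a b = (fun Y => ursellOf m (insert a (insert b Y))) +
      spConv (fun S => ursellOf m (insert a S)) (fun R => ursellOf m (insert b R)) := by
    funext Y; rfl
  rw [hsplit, spConv_add_left, spConv_assoc]
  have h2 : spConv (fun S => ursellOf m (insert a S)) (spConv (fun R => ursellOf m (insert b R)) m) Z' =
      ∑ S ∈ Z'.powerset, ursellOf m (insert a S) * m (insert b (Z' \ S)) := by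
    rw [spConv_apply]
    refine sum_congr rfl fun S _ => ?_
    rw [spConv_apply, sum_powerset_ursellOf_insert_mul m hm0 (fun h => hb (sdiff_subset h))]
  rw [h2, spConv_apply]
  have ha' : a ∉ insert b Z' := fun h => (mem_insert.1 h).elim hab ha
  rw [← sum_powerset_ursellOf_insert_mul m hm0 ha', sum_powerset_insert hb, add_comm]
  refine congr_arg₂ (· + ·) (sum_congr rfl fun S hS => ?_) (sum_congr rfl fun S hS => ?_)
  · rw [Finset.insert_sdiff_of_notMem _ (fun h => hb (mem_powerset.1 hS h))]
  · rw [Finset.insert_sdiff_insert, Finset.sdiff_insert_of_notMem hb]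

end Generic

/-! ### The moment set function of a pair interaction and its derivative in one coupling -/

section Spin

variable {ι : Type*} [Fintype ι] [DecidableEq ι]

open PairIsing

/-- The moments `⟨σ_B⟩_c` as a set function. [cite: CamiaJiangNewman2023, §1.1] -/
def Mspin (c : ι → ι → ℝ) (B : Finset ι) : ℝ := avg c (spinProduct B)

/-- `⟨σ_∅⟩ = 1`. [folklore] -/
theorem Mspin_empty (c : ι → ι → ℝ) : Mspin c ∅ = 1 := by
  have h : spinProduct (∅ : Finset ι) = fun _ => (1 : ℝ) := funext fun σ => prod_empty
  rw [Mspin, h]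
  exact avg_const c 1

/-- **The dictionary**: `⟨σ_B⟩_c = Z_K[B]/Z_K[∅]` for `c ≥ 0`. [cite: Panis2023Triviality, §4.1] -/
theorem Mspin_eq_corrK {c : ι → ι → ℝ} (hc : ∀ a b, 0 ≤ c a b) : Mspin c = Current.corrK (edgeK c) :=
  funext fun B => avg_spinProduct_eq_div hc B

/-- The Ursell function of `2k` distinct sites is `ursellOf` of the moments (Möbius formula). [cite: CamiaJiangNewman2023, §1.1 eq. (2)] -/
theorem ursell_eq_ursellOf_Mspin (c : ι → ι → ℝ) {n : ℕ} (hn : 0 < n) {j : Fin n → ι} (hj : Function.Injective j) :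
    PairIsing.ursell c j = ursellOf (Mspin c) ((univ : Finset (Fin n)).map ⟨j, hj⟩) := by
  have huniv : (univ : Finset (Fin n)).Nonempty := univ_nonempty_iff.2 ⟨⟨0, hn⟩⟩
  rw [← ursellOf_map ⟨j, hj⟩ (Mspin c) univ,
    ursellOf_eq_sum_setPartitions (fun B => Mspin c (B.map ⟨j, hj⟩)) (by simp [Mspin_empty]) huniv, PairIsing.ursell,
    sum_finpartition_eq_sum_setPartitions (f := fun π => (-1 : ℝ) ^ (π.card - 1) * ((π.card - 1).factorial : ℝ) *
      ∏ B ∈ π, avg c (fun σ => ∏ i ∈ B, spinAt (j i) σ))]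
  refine sum_congr rfl fun π _ => ?_
  congr 1
  refine prod_congr rfl fun B _ => ?_
  rw [Mspin]
  congr 1
  funext σ
  rw [spinProduct, prod_map]
  rfl

/-- The derivative of a moment in one coupling entry: `d/dt ⟨σ_B⟩_{c_t} = ⟨σ_Bσ_aσ_b⟩ - ⟨σ_B⟩⟨σ_aσ_b⟩ =
⟨σ_{B+a+b}⟩ - ⟨σ_B⟩⟨σ_{ab}⟩` for `a ≠ b ∉ B`. [cite: CamiaJiangNewman2023, §2 eq. (21)] -/
theorem hasDerivAt_Mspin (c : ι → ι → ℝ) {a b : ι} (hab : a ≠ b) {B : Finset ι} (ha : a ∉ B) (hb : b ∉ B) (t : ℝ) :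
    HasDerivAt (fun t => Mspin (setCoupling c a b t) B)
      (Mspin (setCoupling c a b t) (insert a (insert b B)) -
        Mspin (setCoupling c a b t) B * Mspin (setCoupling c a b t) {a, b}) t := by
  have h := hasDerivAt_avg_setCoupling c a b (spinProduct B) t
  rw [spinProduct_mul_pair ha hb hab, spinAt_mul_spinAt_eq_spinProduct_pair hab] at h
  have hset : B ∪ {a, b} = insert a (insert b B) := by
    ext x
    simp only [mem_union, mem_insert, mem_singleton]
    tauto
  simpa only [Mspin, hset] using h

/-- Moments are differentiable in one coupling entry. [folklore] -/
theorem differentiable_Mspin (c : ι → ι → ℝ) (a b : ι) (B : Finset ι) :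
    Differentiable ℝ (fun t => Mspin (setCoupling c a b t) B) :=
  differentiable_avg_setCoupling c a b _

/-- Ursell functions of the moments are differentiable in one coupling entry (strong induction on the set through the
Möbius recursion). [folklore] -/
theorem differentiable_ursellOf_Mspin (c : ι → ι → ℝ) (a b : ι) (B : Finset ι) :
    Differentiable ℝ (fun t => ursellOf (Mspin (setCoupling c a b t)) B) := by
  induction B using Finset.strongInduction with
  | H B ih =>
    have hfun : (fun t => ursellOf (Mspin (setCoupling c a b t)) B) = fun t =>
        Mspin (setCoupling c a b t) B -
          ∑ π ∈ (setPartitions B).erase {B}, ∏ P ∈ π, ursellOf (Mspin (setCoupling c a b t)) P := by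
      funext t; rw [ursellOf_eq]
    rw [hfun]
    refine (differentiable_Mspin c a b B).sub (Differentiable.fun_sum fun π hπ => ?_)
    refine Differentiable.fun_finsetProd fun P hP => ?_
    obtain ⟨hne, hπ'⟩ := mem_erase.1 hπ
    exact ih P ((mem_setPartitions.1 hπ').ssubset_of_ne_singleton hne hP)

/-- **CJN eq. (20) as an identity of set functions**: for `a ≠ b` off `X ≠ ∅`,
`d/dt|_{t₀} uᵀ_{c_t}(X) = D_{ab}(⟨σ⟩_{c_{t₀}})(X)`.  Differentiate the block recursion
`⟨σ_{Y+v}⟩ = Σ_{Z ⊆ Y} u(Z+v) ⟨σ_{Y∖Z}⟩` (`v ∈ X`, `Y ⊆ X ∖ v`), use `D_{ab} ⋆ ⟨σ⟩ = ⟨σ_{·+a+b}⟩`, and deconvolve.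
[cite: CamiaJiangNewman2023, §2 eq. (20)] -/
theorem deriv_ursellOf_Mspin_eq_DabOf (c : ι → ι → ℝ) {a b : ι} (hab : a ≠ b) {X : Finset ι} (haX : a ∉ X)
    (hbX : b ∉ X) (hX : X.Nonempty) (t₀ : ℝ) :
    deriv (fun t => ursellOf (Mspin (setCoupling c a b t)) X) t₀ = DabOf (Mspin (setCoupling c a b t₀)) a b X := by
  obtain ⟨v, hv⟩ := hX
  set M : ℝ → Finset ι → ℝ := fun t => Mspin (setCoupling c a b t) with hM
  set u : ℝ → Finset ι → ℝ := fun t => ursellOf (M t) with hu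
  set u' : Finset ι → ℝ := fun B => deriv (fun t => u t B) t₀ with hu'
  have hM0 : ∀ t, M t ∅ = 1 := fun t => Mspin_empty _
  have hdu : ∀ B, HasDerivAt (fun t => u t B) (u' B) t₀ := fun B =>
    (differentiable_ursellOf_Mspin c a b B t₀).hasDerivAt
  have hdM : ∀ B, a ∉ B → b ∉ B → HasDerivAt (fun t => M t B)
      (M t₀ (insert a (insert b B)) - M t₀ B * M t₀ {a, b}) t₀ := fun B ha hb => hasDerivAt_Mspin c hab ha hb t₀
  -- Step 1: the differentiated block recursion, for `Y ⊆ X \ v`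
  have step1 : ∀ Y ⊆ X.erase v,
      ∑ Z ∈ Y.powerset, u' (insert v Z) * M t₀ (Y \ Z) =
        ∑ Z ∈ Y.powerset, DabOf (M t₀) a b (insert v Z) * M t₀ (Y \ Z) := by
    intro Y hY
    have hvY : v ∉ Y := fun h => (notMem_erase v X) (hY h)
    have hYX : Y ⊆ X := hY.trans (erase_subset v X)
    have haY : a ∉ Y := fun h => haX (hYX h)
    have hbY : b ∉ Y := fun h => hbX (hYX h)
    have havY : a ∉ insert v Y := fun h => (mem_insert.1 h).elim (fun h => haX (h ▸ hv)) haY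
    have hbvY : b ∉ insert v Y := fun h => (mem_insert.1 h).elim (fun h => hbX (h ▸ hv)) hbY
    -- derivative of the left-hand side of the block recursion
    have hF : HasDerivAt (fun t => ∑ Z ∈ Y.powerset, u t (insert v Z) * M t (Y \ Z))
        (∑ Z ∈ Y.powerset, (u' (insert v Z) * M t₀ (Y \ Z) +
          u t₀ (insert v Z) * (M t₀ (insert a (insert b (Y \ Z))) - M t₀ (Y \ Z) * M t₀ {a, b}))) t₀ := by
      refine HasDerivAt.fun_sum fun Z hZ => ?_
      have hZY := mem_powerset.1 hZ
      exact (hdu (insert v Z)).mul (hdM (Y \ Z) (fun h => haY (sdiff_subset h)) (fun h => hbY (sdiff_subset h)))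
    -- the block recursion holds for all `t`, so the derivatives agree
    have hfun : (fun t => ∑ Z ∈ Y.powerset, u t (insert v Z) * M t (Y \ Z)) = fun t => M t (insert v Y) := by
      funext t; exact sum_powerset_ursellOf_insert_mul (M t) (hM0 t) hvY
    rw [hfun] at hF
    have hEq := hF.unique (hdM (insert v Y) havY hbvY)
    -- rearrange: Σ u' M = M(a+b+v+Y) - Σ_Z u(v+Z) M(a+b+(Y\Z))
    rw [sum_add_distrib] at hEq
    have hsecond : ∑ Z ∈ Y.powerset, u t₀ (insert v Z) * (M t₀ (insert a (insert b (Y \ Z))) - M t₀ (Y \ Z) * M t₀ {a, b}) =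
        ∑ Z ∈ Y.powerset, u t₀ (insert v Z) * M t₀ (insert a (insert b (Y \ Z))) -
          M t₀ {a, b} * M t₀ (insert v Y) := by
      rw [← sum_powerset_ursellOf_insert_mul (M t₀) (hM0 t₀) hvY, mul_sum, ← sum_sub_distrib]
      exact sum_congr rfl fun Z _ => by simp only [hu]; ring
    rw [hsecond] at hEq
    have hL : ∑ Z ∈ Y.powerset, u' (insert v Z) * M t₀ (Y \ Z) =
        M t₀ (insert a (insert b (insert v Y))) - ∑ Z ∈ Y.powerset, u t₀ (insert v Z) * M t₀ (insert a (insert b (Y \ Z))) := by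
      linarith
    rw [hL]
    -- the right-hand side: split `D ⋆ M` at `insert v Y` according to `v ∈ T`
    have hD := spConv_DabOf (M t₀) (hM0 t₀) hab havY hbvY
    rw [spConv_apply, sum_powerset_insert hvY] at hD
    -- the `v ∉ T` part is `Σ_S u(v+S) M(a+b+(Y\S))`
    have hpart : ∑ Z ∈ Y.powerset, DabOf (M t₀) a b Z * M t₀ (insert v Y \ Z) =
        ∑ S ∈ Y.powerset, u t₀ (insert v S) * M t₀ (insert a (insert b (Y \ S))) := by
      have h1 : ∀ Z ∈ Y.powerset, DabOf (M t₀) a b Z * M t₀ (insert v Y \ Z) =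
          ∑ S ∈ (Y \ Z).powerset, DabOf (M t₀) a b Z * (u t₀ (insert v S) * M t₀ ((Y \ Z) \ S)) := by
        intro Z hZ
        have hvZ : v ∉ Z := fun h => hvY (mem_powerset.1 hZ h)
        rw [Finset.insert_sdiff_of_notMem _ hvZ, ← mul_sum,
          sum_powerset_ursellOf_insert_mul (M t₀) (hM0 t₀) (fun h => hvY (sdiff_subset h))]
      rw [sum_congr rfl h1, sum_powerset_sdiff_comm Y (fun Z S => DabOf (M t₀) a b Z * (u t₀ (insert v S) * M t₀ ((Y \ Z) \ S)))]
      refine sum_congr rfl fun S hS => ?_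
      have hSY := mem_powerset.1 hS
      have h2 : ∑ Z ∈ (Y \ S).powerset, DabOf (M t₀) a b Z * (u t₀ (insert v S) * M t₀ ((Y \ Z) \ S)) =
          u t₀ (insert v S) * spConv (DabOf (M t₀) a b) (M t₀) (Y \ S) := by
        rw [spConv_apply, mul_sum]
        refine sum_congr rfl fun Z _ => ?_
        rw [sdiff_right_comm]; ring
      rw [h2, spConv_DabOf (M t₀) (hM0 t₀) hab (fun h => haY (sdiff_subset h)) (fun h => hbY (sdiff_subset h))]
    rw [hpart] at hD
    have hins : ∀ Z ∈ Y.powerset, DabOf (M t₀) a b (insert v Z) * M t₀ (insert v Y \ insert v Z) =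
        DabOf (M t₀) a b (insert v Z) * M t₀ (Y \ Z) := by
      intro Z _; rw [Finset.insert_sdiff_insert, Finset.sdiff_insert_of_notMem hvY]
    rw [sum_congr rfl hins] at hD
    linarith
  -- Step 2: deconvolution on the subsets of `X \ v`
  have hMN : ∀ Z, spConv (M t₀) (spExp (-u t₀)) Z = spOne Z := by
    intro Z
    have hMexp : M t₀ = spExp (u t₀) := funext fun B => (spExp_ursellOf (M t₀) (hM0 t₀) B).symm
    rw [hMexp, spConv_spExp_neg]
  have h := deconv (f := fun Z => u' (insert v Z)) (f' := fun Z => DabOf (M t₀) a b (insert v Z)) hMN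
    (Y := X.erase v) (fun Y hY => step1 Y hY)
  simp only [insert_erase hv] at h
  exact h

/-- **CJN eq. (20)**: for `c ≥ 0`, distinct sites `j` and `a ≠ b` off the sites,
`d/dt|_{t=c_{ab}} u_{2k}(setCoupling c a b t; j) = D_{ab}(K)(range j)` with `K = edgeK c` the couplings of the
random-current dictionary. [cite: CamiaJiangNewman2023, §2 eq. (20)] -/
theorem deriv_ursell_setCoupling_eq_Dab {c : ι → ι → ℝ} (hc : ∀ a b, 0 ≤ c a b) {a b : ι} (hab : a ≠ b) {n : ℕ}
    (hn : 0 < n) {j : Fin n → ι} (hj : Function.Injective j) (ha : a ∉ Set.range j) (hb : b ∉ Set.range j) :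
    deriv (fun t => PairIsing.ursell (setCoupling c a b t) j) (c a b) =
      Current.Dab (edgeK c) a b ((univ : Finset (Fin n)).map ⟨j, hj⟩) := by
  set X : Finset ι := (univ : Finset (Fin n)).map ⟨j, hj⟩ with hXdef
  have hfun : (fun t => PairIsing.ursell (setCoupling c a b t) j) = fun t => ursellOf (Mspin (setCoupling c a b t)) X :=
    funext fun t => ursell_eq_ursellOf_Mspin _ hn hj
  have haX : a ∉ X := fun h => by
    obtain ⟨i, -, hi⟩ := mem_map.1 h
    exact ha ⟨i, hi⟩
  have hbX : b ∉ X := fun h => by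
    obtain ⟨i, -, hi⟩ := mem_map.1 h
    exact hb ⟨i, hi⟩
  have hX : X.Nonempty := (univ_nonempty_iff.2 ⟨⟨0, hn⟩⟩).map
  rw [hfun, deriv_ursellOf_Mspin_eq_DabOf c hab haX hbX hX, setCoupling_self, Mspin_eq_corrK hc]
  rfl

end Spin

/-! ### Enumerations, the cut interaction, monotonicity at a fixed order -/

section Order

variable {ι : Type} [Fintype ι] [DecidableEq ι]

open PairIsing

/-- The pair interaction with every entry meeting `A` set to `0`. [cite: Shlosman1986, §2] -/
def cutAt (c : ι → ι → ℝ) (A : Finset ι) : ι → ι → ℝ := fun a b => if a ∈ A ∨ b ∈ A then 0 else c a b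

omit [Fintype ι] in
/-- The cut interaction is nonnegative. [folklore] -/
theorem cutAt_nonneg {c : ι → ι → ℝ} (hc : ∀ a b, 0 ≤ c a b) (A : Finset ι) : ∀ a b, 0 ≤ cutAt c A a b := by
  intro a b; unfold cutAt; split_ifs; exacts [le_rfl, hc a b]

omit [Fintype ι] in
/-- The cut interaction is dominated by the original one. [folklore] -/
theorem cutAt_le {c : ι → ι → ℝ} (hc : ∀ a b, 0 ≤ c a b) (A : Finset ι) : ∀ a b, cutAt c A a b ≤ c a b := by
  intro a b; unfold cutAt; split_ifs; exacts [hc a b, le_rfl]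

/-- The couplings of the cut interaction are the cut couplings. [folklore] -/
theorem edgeK_cutAt (c : ι → ι → ℝ) (A : Finset ι) : edgeK (cutAt c A) = cutCoupling (edgeK c) A := by
  funext e
  obtain ⟨e, he⟩ := e
  induction e using Sym2.ind with
  | _ p q =>
    rw [cutCoupling]
    change pairEdgeWeight (cutAt c A) 2 ⟨s(p, q), he⟩ = if Current.EdgeOff A s(p, q) then pairEdgeWeight c 2 ⟨s(p, q), he⟩ else 0
    rw [pairEdgeWeight_apply_mk, pairEdgeWeight_apply_mk]
    unfold cutAt
    by_cases h : Current.EdgeOff A s(p, q)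
    · rw [if_pos h]
      obtain ⟨hp, hq⟩ := Current.edgeOff_mk.1 h
      simp [hp, hq]
    · rw [if_neg h]
      rw [Current.edgeOff_mk, not_and_or, not_not, not_not] at h
      rcases h with hp | hq
      · simp [hp]
      · simp [hq]

/-- Ursell functions of a set of sites through the random-current dictionary: `uK(K)(range j) = u(c; j)`.
[cite: CamiaJiangNewman2023, §1.1 eq. (2)] -/
theorem uK_edgeK_map {c : ι → ι → ℝ} (hc : ∀ a b, 0 ≤ c a b) {n : ℕ} (hn : 0 < n) {j : Fin n → ι}
    (hj : Function.Injective j) :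
    Current.uK (edgeK c) ((univ : Finset (Fin n)).map ⟨j, hj⟩) = PairIsing.ursell c j := by
  rw [ursell_eq_ursellOf_Mspin c hn hj, Current.uK, ← Mspin_eq_corrK hc]

omit [Fintype ι] [DecidableEq ι] in
/-- Every finite set of sites is the range of an injective enumeration. [folklore] -/
theorem exists_enum (V : Finset ι) {n : ℕ} (hV : #V = n) :
    ∃ j : Fin n → ι, ∃ hj : Function.Injective j, (univ : Finset (Fin n)).map ⟨j, hj⟩ = V := by
  subst hV
  refine ⟨fun i => (V.equivFin.symm i).1, fun i i' h => V.equivFin.symm.injective (Subtype.ext h), ?_⟩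
  ext x
  constructor
  · intro hx
    obtain ⟨i, -, rfl⟩ := Finset.mem_map.1 hx
    exact (V.equivFin.symm i).2
  · intro hx
    refine Finset.mem_map.2 ⟨V.equivFin ⟨x, hx⟩, mem_univ _, ?_⟩
    show (V.equivFin.symm (V.equivFin ⟨x, hx⟩)).1 = x
    rw [Equiv.symm_apply_apply]

/-- **Monotonicity in one entry at a fixed order** (from the derivative statement at that order; the per-level
form of `monotoneOn_ursell_setCoupling` of `UrsellMonotonicityProofs`). [cite: CamiaJiangNewman2023, Thm 1] -/
theorem monotoneOn_ursell_setCoupling_of_level {k : ℕ}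
    (hT : ∀ (ι : Type) [Fintype ι] [DecidableEq ι] (c : ι → ι → ℝ), (∀ a b, 0 ≤ c a b) →
      ∀ (j : Fin (2 * k) → ι) (u₀ v₀ : ι), u₀ ≠ v₀ →
        0 ≤ (-1 : ℝ) ^ (k - 1) * deriv (fun t : ℝ => PairIsing.ursell (setCoupling c u₀ v₀ t) j) (c u₀ v₀))
    {c : ι → ι → ℝ} (hc : ∀ a b, 0 ≤ c a b) (j : Fin (2 * k) → ι) {u₀ v₀ : ι} (huv : u₀ ≠ v₀) :
    MonotoneOn (fun t => (-1 : ℝ) ^ (k - 1) * PairIsing.ursell (setCoupling c u₀ v₀ t) j) (Set.Ici 0) := by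
  have hd := differentiable_ursell_setCoupling c u₀ v₀ j
  refine monotoneOn_of_deriv_nonneg (convex_Ici 0) ?_ ?_ fun x hx => ?_
  · exact ((continuous_const.mul hd.continuous)).continuousOn
  · exact (hd.const_mul _).differentiableOn
  · rw [interior_Ici, Set.mem_Ioi] at hx
    rw [deriv_const_mul _ (hd x)]
    have key := hT ι (setCoupling c u₀ v₀ x) (setCoupling_nonneg hc u₀ v₀ hx.le) j u₀ v₀ huv
    simpa only [setCoupling_setCoupling, setCoupling_apply_same] using key

/-- Raising one entry raises `(-1)^{k-1} u_{2k}` (per-level form). [cite: CamiaJiangNewman2023, Thm 1] -/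
theorem ursell_le_setCoupling_of_level {k : ℕ}
    (hT : ∀ (ι : Type) [Fintype ι] [DecidableEq ι] (c : ι → ι → ℝ), (∀ a b, 0 ≤ c a b) →
      ∀ (j : Fin (2 * k) → ι) (u₀ v₀ : ι), u₀ ≠ v₀ →
        0 ≤ (-1 : ℝ) ^ (k - 1) * deriv (fun t : ℝ => PairIsing.ursell (setCoupling c u₀ v₀ t) j) (c u₀ v₀))
    {c : ι → ι → ℝ} (hc : ∀ a b, 0 ≤ c a b) (j : Fin (2 * k) → ι) (u₀ v₀ : ι) {t : ℝ} (ht : c u₀ v₀ ≤ t) :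
    (-1 : ℝ) ^ (k - 1) * PairIsing.ursell c j ≤ (-1 : ℝ) ^ (k - 1) * PairIsing.ursell (setCoupling c u₀ v₀ t) j := by
  by_cases huv : u₀ = v₀
  · subst huv
    rw [ursell_setCoupling_diag]
  · have hmono := monotoneOn_ursell_setCoupling_of_level hT hc j huv
    have h := hmono (show c u₀ v₀ ∈ Set.Ici (0 : ℝ) from hc u₀ v₀)
      (show t ∈ Set.Ici (0 : ℝ) from (hc u₀ v₀).trans ht) ht
    simpa only [setCoupling_self] using h

/-- **`(-1)^{k-1} u_{2k}` is increasing in the couplings, at a fixed order** (per-level form of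
`ursell_mono_of_thm1`). [cite: CamiaJiangNewman2023, Thm 1] -/
theorem ursell_mono_of_level {k : ℕ}
    (hT : ∀ (ι : Type) [Fintype ι] [DecidableEq ι] (c : ι → ι → ℝ), (∀ a b, 0 ≤ c a b) →
      ∀ (j : Fin (2 * k) → ι) (u₀ v₀ : ι), u₀ ≠ v₀ →
        0 ≤ (-1 : ℝ) ^ (k - 1) * deriv (fun t : ℝ => PairIsing.ursell (setCoupling c u₀ v₀ t) j) (c u₀ v₀))
    {c c' : ι → ι → ℝ} (hc : ∀ a b, 0 ≤ c a b) (hcc' : ∀ a b, c a b ≤ c' a b) (j : Fin (2 * k) → ι) :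
    (-1 : ℝ) ^ (k - 1) * PairIsing.ursell c j ≤ (-1 : ℝ) ^ (k - 1) * PairIsing.ursell c' j := by
  suffices H : ∀ S : Finset (ι × ι), (-1 : ℝ) ^ (k - 1) * PairIsing.ursell c j ≤
      (-1 : ℝ) ^ (k - 1) * PairIsing.ursell (fun a b => if (a, b) ∈ S then c' a b else c a b) j by
    simpa using H Finset.univ
  intro S
  induction S using Finset.induction_on with
  | empty => simp
  | insert p S hp ih =>
    refine ih.trans ?_
    set d : ι → ι → ℝ := fun a b => if (a, b) ∈ S then c' a b else c a b with hd
    have hd0 : ∀ a b, 0 ≤ d a b := fun a b => by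
      simp only [hd]; split_ifs; exacts [(hc a b).trans (hcc' a b), hc a b]
    have hstep : (fun a b => if (a, b) ∈ insert p S then c' a b else c a b) = setCoupling d p.1 p.2 (c' p.1 p.2) := by
      funext a b
      simp only [hd, setCoupling, Finset.mem_insert]
      by_cases hab : a = p.1 ∧ b = p.2
      · obtain ⟨rfl, rfl⟩ := hab
        simp
      · have hne : (a, b) ≠ p := fun h => hab ⟨by rw [← h], by rw [← h]⟩
        simp [hab, hne]
    rw [hstep]
    refine ursell_le_setCoupling_of_level hT hd0 j p.1 p.2 ?_
    simp only [hd]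
    split_ifs
    exacts [le_rfl, hcc' _ _]

/-- **The clone reduction at a fixed order** (per-level form of `CamiaJiangNewman2023_thm1_of_injective`).
[cite: CamiaJiangNewman2023, Thm 1 and §4] -/
theorem levelT_of_clean {k : ℕ}
    (H : ∀ (ι : Type) [Fintype ι] [DecidableEq ι] (c : ι → ι → ℝ), (∀ a b, 0 ≤ c a b) →
      ∀ (j : Fin (2 * k) → ι) (u₀ v₀ : ι), Function.Injective j → u₀ ∉ Set.range j → v₀ ∉ Set.range j → u₀ ≠ v₀ →
        0 ≤ (-1 : ℝ) ^ (k - 1) * deriv (fun t : ℝ => PairIsing.ursell (setCoupling c u₀ v₀ t) j) (c u₀ v₀))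
    (ι : Type) [Fintype ι] [DecidableEq ι] (c : ι → ι → ℝ) (hc : ∀ a b, 0 ≤ c a b) (j : Fin (2 * k) → ι)
    (u₀ v₀ : ι) (huv : u₀ ≠ v₀) :
    0 ≤ (-1 : ℝ) ^ (k - 1) * deriv (fun t : ℝ => PairIsing.ursell (setCoupling c u₀ v₀ t) j) (c u₀ v₀) := by
  have key := H (ι ⊕ Fin (2 * k)) (PairIsing.cloneCoupling c j 1)
    (PairIsing.cloneCoupling_nonneg hc j zero_le_one) Sum.inr (Sum.inl u₀) (Sum.inl v₀)
    Sum.inr_injective (by simp) (by simp) (by simpa using huv)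
  have hfun : (fun t : ℝ => PairIsing.ursell
      (setCoupling (PairIsing.cloneCoupling c j 1) (Sum.inl u₀) (Sum.inl v₀) t) Sum.inr) =
      fun t => Real.tanh 1 ^ (2 * k) * PairIsing.ursell (setCoupling c u₀ v₀ t) j := by
    funext t
    rw [← PairIsing.cloneCoupling_setCoupling, PairIsing.ursell_cloneCoupling]
  rw [hfun, PairIsing.cloneCoupling_inl_inl,
    deriv_const_mul _ ((PairIsing.differentiable_ursell_setCoupling c u₀ v₀ j) _)] at key
  have hpos : 0 < Real.tanh 1 ^ (2 * k) := by
    refine pow_pos ?_ _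
    rw [Real.tanh_eq_sinh_div_cosh]
    exact div_pos (Real.sinh_pos_iff.2 one_pos) (Real.cosh_pos 1)
  rw [mul_left_comm] at key
  exact nonneg_of_mul_nonneg_right (by simpa [mul_comm] using key) hpos

end Order

/-! ### The joint induction on the order -/

section Induction

open PairIsing

/-- **The signed monotonicity of the random-current Ursell set function under cutting**, at a fixed order.
[cite: CamiaJiangNewman2023, Thm 1] -/
theorem uK_cut_le {m : ℕ} (hm : 1 ≤ m)
    (hT : ∀ (ι : Type) [Fintype ι] [DecidableEq ι] (c : ι → ι → ℝ), (∀ a b, 0 ≤ c a b) →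
      ∀ (j : Fin (2 * m) → ι) (u₀ v₀ : ι), u₀ ≠ v₀ →
        0 ≤ (-1 : ℝ) ^ (m - 1) * deriv (fun t : ℝ => PairIsing.ursell (setCoupling c u₀ v₀ t) j) (c u₀ v₀))
    {ι : Type} [Fintype ι] [DecidableEq ι] {c : ι → ι → ℝ} (hc : ∀ a b, 0 ≤ c a b) (A V : Finset ι)
    (hV : #V = 2 * m) :
    (-1 : ℝ) ^ (m - 1) * Current.uK (cutCoupling (edgeK c) A) V ≤ (-1 : ℝ) ^ (m - 1) * Current.uK (edgeK c) V := by
  obtain ⟨j, hj, hjV⟩ := exists_enum V hV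
  have hn : 0 < 2 * m := by omega
  rw [← edgeK_cutAt, ← hjV, uK_edgeK_map hc hn hj, uK_edgeK_map (cutAt_nonneg hc A) hn hj]
  exact ursell_mono_of_level hT (cutAt_nonneg hc A) (cutAt_le hc A) j

/-- **The block signs**: `(-1)^{#V/2} (-δ_A u(V)) ≥ 0` for nonempty `V` of order below `2k`, from the sign
statement (blocks meeting `A`) and the derivative statement (blocks off `A`, by monotonicity) at the lower orders.
[cite: Shlosman1986, §2] -/
theorem neg_dU_sign {k : ℕ}
    (IHS : ∀ m, 1 ≤ m → m < k → ∀ (ι : Type) [Fintype ι] [DecidableEq ι] (c : ι → ι → ℝ), (∀ a b, 0 ≤ c a b) →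
      ∀ W : Finset ι, #W = 2 * m → 0 ≤ (-1 : ℝ) ^ (m - 1) * Current.uK (edgeK c) W)
    (IHT : ∀ m, 1 ≤ m → m < k → ∀ (ι : Type) [Fintype ι] [DecidableEq ι] (c : ι → ι → ℝ), (∀ a b, 0 ≤ c a b) →
      ∀ (j : Fin (2 * m) → ι) (u₀ v₀ : ι), u₀ ≠ v₀ →
        0 ≤ (-1 : ℝ) ^ (m - 1) * deriv (fun t : ℝ => PairIsing.ursell (setCoupling c u₀ v₀ t) j) (c u₀ v₀))
    {ι : Type} [Fintype ι] [DecidableEq ι] {c : ι → ι → ℝ} (hc : ∀ a b, 0 ≤ c a b) (A V : Finset ι)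
    (hV : V.Nonempty) (hVk : #V < 2 * k) :
    0 ≤ (-1 : ℝ) ^ (#V / 2) * (-Current.dU (edgeK c) A V) := by
  rcases Nat.even_or_odd #V with ⟨m, hm⟩ | hodd
  · have hm2 : #V = 2 * m := by omega
    have hm1 : 1 ≤ m := by have := card_pos.2 hV; omega
    have hmk : m < k := by omega
    have hdiv : #V / 2 = m := by omega
    rw [hdiv]
    have hsign : (-1 : ℝ) ^ m = -(-1 : ℝ) ^ (m - 1) := by
      conv_lhs => rw [show m = m - 1 + 1 by omega, pow_succ]
      ring
    -- in both cases `(-1)^{m-1} δ_A u(V) ≥ 0`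
    have key : 0 ≤ (-1 : ℝ) ^ (m - 1) * Current.dU (edgeK c) A V := by
      unfold Current.dU
      by_cases hd : Disjoint V A
      · have h := uK_cut_le hm1 (IHT m hm1 hmk) hc A V hm2
        linarith
      · rw [Current.uK_cutCoupling_eq_zero (edgeK c) hd, sub_zero]
        exact IHS m hm1 hmk ι c hc V hm2
    rw [hsign]; linarith
  · rw [Current.dU_eq_zero_of_odd (edgeK c) A hodd]; simp

/-- **Sign of `e_A^{(2)}(R)`**: `(-1)^{#R/2} e_A^{(2)}(R) ≥ 0` for `#R < 2k`. [cite: Shlosman1986, §2] -/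
theorem eA_two_sign {k : ℕ}
    (IHS : ∀ m, 1 ≤ m → m < k → ∀ (ι : Type) [Fintype ι] [DecidableEq ι] (c : ι → ι → ℝ), (∀ a b, 0 ≤ c a b) →
      ∀ W : Finset ι, #W = 2 * m → 0 ≤ (-1 : ℝ) ^ (m - 1) * Current.uK (edgeK c) W)
    (IHT : ∀ m, 1 ≤ m → m < k → ∀ (ι : Type) [Fintype ι] [DecidableEq ι] (c : ι → ι → ℝ), (∀ a b, 0 ≤ c a b) →
      ∀ (j : Fin (2 * m) → ι) (u₀ v₀ : ι), u₀ ≠ v₀ →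
        0 ≤ (-1 : ℝ) ^ (m - 1) * deriv (fun t : ℝ => PairIsing.ursell (setCoupling c u₀ v₀ t) j) (c u₀ v₀))
    {ι : Type} [Fintype ι] [DecidableEq ι] {c : ι → ι → ℝ} (hc : ∀ a b, 0 ≤ c a b) (A R : Finset ι)
    (hR : #R < 2 * k) :
    0 ≤ (-1 : ℝ) ^ (#R / 2) * Current.eA (edgeK c) A 2 R := by
  rw [Current.eA, spExp, mul_sum]
  refine sum_nonneg fun π hπ => ?_
  have hsp := mem_setPartitions.1 hπ
  by_cases hall : ∀ P ∈ π, Even #P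
  · -- all blocks even: distribute the sign over the blocks
    have hsum : #R / 2 = ∑ P ∈ π, #P / 2 := by
      have h := hsp.sum_card
      have h2 : ∑ P ∈ π, #P = 2 * ∑ P ∈ π, (#P / 2) := by
        rw [mul_sum]; exact sum_congr rfl fun P hP => by obtain ⟨r, hr⟩ := hall P hP; omega
      omega
    rw [hsum, ← prod_pow_eq_pow_sum, ← prod_mul_distrib]
    refine prod_nonneg fun P hP => ?_
    have h := neg_dU_sign IHS IHT hc A P (hsp.nonempty_of_mem hP)
      (lt_of_le_of_lt (card_le_card (hsp.subset hP)) hR)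
    have : (-1 : ℝ) ^ (#P / 2) * -(2 * Current.dU (edgeK c) A P) = 2 * ((-1 : ℝ) ^ (#P / 2) * -Current.dU (edgeK c) A P) := by
      ring
    rw [this]; positivity
  · -- an odd block kills the term
    have hall' : ∃ P ∈ π, ¬ Even #P := by
      by_contra h'
      exact hall fun P hP => by_contra fun hne => h' ⟨P, hP, hne⟩
    obtain ⟨P, hP, hPodd⟩ := hall'
    rw [prod_eq_zero hP (by rw [Current.dU_eq_zero_of_odd (edgeK c) A (Nat.not_even_iff_odd.1 hPodd)]; ring)]
    simp

/-- **The sign statement at order `2k`** from `masterB` and the lower orders. [cite: Shlosman1986, Thm 1] -/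
theorem sign_step {k : ℕ} (hk : 1 ≤ k)
    (IHS : ∀ m, 1 ≤ m → m < k → ∀ (ι : Type) [Fintype ι] [DecidableEq ι] (c : ι → ι → ℝ), (∀ a b, 0 ≤ c a b) →
      ∀ W : Finset ι, #W = 2 * m → 0 ≤ (-1 : ℝ) ^ (m - 1) * Current.uK (edgeK c) W)
    (IHT : ∀ m, 1 ≤ m → m < k → ∀ (ι : Type) [Fintype ι] [DecidableEq ι] (c : ι → ι → ℝ), (∀ a b, 0 ≤ c a b) →
      ∀ (j : Fin (2 * m) → ι) (u₀ v₀ : ι), u₀ ≠ v₀ →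
        0 ≤ (-1 : ℝ) ^ (m - 1) * deriv (fun t : ℝ => PairIsing.ursell (setCoupling c u₀ v₀ t) j) (c u₀ v₀))
    (ι : Type) [Fintype ι] [DecidableEq ι] (c : ι → ι → ℝ) (hc : ∀ a b, 0 ≤ c a b) (W : Finset ι) (hW : #W = 2 * k) :
    0 ≤ (-1 : ℝ) ^ (k - 1) * Current.uK (edgeK c) W := by
  have hK := edgeK_nonneg hc
  obtain ⟨w₀, hw₀⟩ : W.Nonempty := card_pos.1 (by omega)
  have hB := Current.masterB hK hW hw₀
  -- every term of the right-hand side has the sign `(-1)^{k-1}`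
  have hterms : 0 ≤ (-1 : ℝ) ^ (k - 1) *
      ∑ x ∈ W.erase w₀, ∑ A : Finset ι, Current.cw (edgeK c) w₀ A {w₀, x} * Current.eA (edgeK c) A 2 ((W.erase w₀).erase x) := by
    rw [mul_sum]
    refine sum_nonneg fun x hx => ?_
    rw [mul_sum]
    refine sum_nonneg fun A _ => ?_
    have hcard : #((W.erase w₀).erase x) = 2 * k - 2 := by
      rw [card_erase_of_mem hx, card_erase_of_mem hw₀, hW]; omega
    have he := eA_two_sign IHS IHT hc A ((W.erase w₀).erase x) (by omega)
    rw [hcard, show (2 * k - 2) / 2 = k - 1 by omega] at he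
    have hcw : 0 ≤ Current.cw (edgeK c) w₀ A {w₀, x} := by
      unfold Current.cw; split_ifs; exacts [Current.rhoI_nonneg hK w₀ A _, le_rfl]
    calc (0 : ℝ) ≤ Current.cw (edgeK c) w₀ A {w₀, x} * ((-1 : ℝ) ^ (k - 1) * Current.eA (edgeK c) A 2 ((W.erase w₀).erase x)) :=
          mul_nonneg hcw he
      _ = _ := by ring
  rw [← hB, ← mul_assoc, mul_comm ((-1 : ℝ) ^ (k - 1)), mul_assoc] at hterms
  have hpos : (0 : ℝ) < ((2 * k - 1 : ℕ) : ℝ) := by exact_mod_cast (show 0 < 2 * k - 1 by omega)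
  exact nonneg_of_mul_nonneg_right hterms hpos

/-- **Sign of `ν²`**: `(-1)^{k-1} ν²_{A,b}(R) ≥ 0` for `#R = 2k-1`, `b ∉ R`, from the sign statement at the orders `≤ 2k`
(cut model) and the derivative statement at the lower orders. [cite: Shlosman1986, §2] -/
theorem nu2_sign {k : ℕ} (hk : 1 ≤ k)
    (HS : ∀ m, 1 ≤ m → m ≤ k → ∀ (ι : Type) [Fintype ι] [DecidableEq ι] (c : ι → ι → ℝ), (∀ a b, 0 ≤ c a b) →
      ∀ W : Finset ι, #W = 2 * m → 0 ≤ (-1 : ℝ) ^ (m - 1) * Current.uK (edgeK c) W)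
    (IHT : ∀ m, 1 ≤ m → m < k → ∀ (ι : Type) [Fintype ι] [DecidableEq ι] (c : ι → ι → ℝ), (∀ a b, 0 ≤ c a b) →
      ∀ (j : Fin (2 * m) → ι) (u₀ v₀ : ι), u₀ ≠ v₀ →
        0 ≤ (-1 : ℝ) ^ (m - 1) * deriv (fun t : ℝ => PairIsing.ursell (setCoupling c u₀ v₀ t) j) (c u₀ v₀))
    {ι : Type} [Fintype ι] [DecidableEq ι] {c : ι → ι → ℝ} (hc : ∀ a b, 0 ≤ c a b) (A : Finset ι) {b : ι}
    {R : Finset ι} (hbR : b ∉ R) (hR : #R = 2 * k - 1) :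
    0 ≤ (-1 : ℝ) ^ (k - 1) * Current.nu2 (edgeK c) A b R := by
  rw [Current.nu2, mul_sum]
  refine sum_nonneg fun Z hZ => ?_
  have hZR := mem_powerset.1 hZ
  have hbZ : b ∉ Z := fun h => hbR (hZR h)
  rcases Nat.even_or_odd #Z with hev | ⟨i, hi⟩
  · -- `#(insert b Z)` odd: the cut Ursell function vanishes
    have hodd : Odd #(insert b Z) := by
      rw [card_insert_of_notMem hbZ]; rcases hev with ⟨r, hr⟩; exact ⟨r, by omega⟩
    rw [Current.uK_eq_zero_of_odd _ hodd]; simp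
  · -- `#Z = 2i+1`: sign `(-1)^i` for the cut Ursell function of `insert b Z`, `(-1)^{k-1-i}` for `e^{(2)}(R∖Z)`
    have hcardZ : #(insert b Z) = 2 * (i + 1) := by rw [card_insert_of_notMem hbZ, hi]; ring
    have hle : #Z ≤ #R := card_le_card hZR
    have hi1 : i + 1 ≤ k := by omega
    have hu : 0 ≤ (-1 : ℝ) ^ (i + 1 - 1) * Current.uK (cutCoupling (edgeK c) A) (insert b Z) := by
      rw [← edgeK_cutAt]
      exact HS (i + 1) (by omega) hi1 ι (cutAt c A) (cutAt_nonneg hc A) _ hcardZ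
    have hIHS : ∀ m, 1 ≤ m → m < k → ∀ (ι : Type) [Fintype ι] [DecidableEq ι] (c : ι → ι → ℝ), (∀ a b, 0 ≤ c a b) →
        ∀ W : Finset ι, #W = 2 * m → 0 ≤ (-1 : ℝ) ^ (m - 1) * Current.uK (edgeK c) W :=
      fun m hm hmk => HS m hm hmk.le
    have he := eA_two_sign hIHS IHT hc A (R \ Z) (by rw [card_sdiff_of_subset hZR]; omega)
    have hcardRZ : #(R \ Z) / 2 = k - 1 - i := by rw [card_sdiff_of_subset hZR]; omega
    rw [hcardRZ] at he
    rw [show i + 1 - 1 = i by omega] at hu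
    have hpow : (-1 : ℝ) ^ (k - 1) = (-1 : ℝ) ^ i * (-1 : ℝ) ^ (k - 1 - i) := by
      rw [← pow_add]; congr 1; omega
    rw [hpow]
    calc (0 : ℝ) ≤ ((-1 : ℝ) ^ i * Current.uK (cutCoupling (edgeK c) A) (insert b Z)) *
          ((-1 : ℝ) ^ (k - 1 - i) * Current.eA (edgeK c) A 2 (R \ Z)) := mul_nonneg hu he
      _ = _ := by ring

/-- **The derivative statement at order `2k`, distinct sites off `a, b`** from `masterC`, the sign statement at the
orders `≤ 2k` and the derivative statement at the lower orders. [cite: CamiaJiangNewman2023, Theorem 1] -/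
theorem deriv_step_clean {k : ℕ} (hk : 1 ≤ k)
    (HS : ∀ m, 1 ≤ m → m ≤ k → ∀ (ι : Type) [Fintype ι] [DecidableEq ι] (c : ι → ι → ℝ), (∀ a b, 0 ≤ c a b) →
      ∀ W : Finset ι, #W = 2 * m → 0 ≤ (-1 : ℝ) ^ (m - 1) * Current.uK (edgeK c) W)
    (IHT : ∀ m, 1 ≤ m → m < k → ∀ (ι : Type) [Fintype ι] [DecidableEq ι] (c : ι → ι → ℝ), (∀ a b, 0 ≤ c a b) →
      ∀ (j : Fin (2 * m) → ι) (u₀ v₀ : ι), u₀ ≠ v₀ →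
        0 ≤ (-1 : ℝ) ^ (m - 1) * deriv (fun t : ℝ => PairIsing.ursell (setCoupling c u₀ v₀ t) j) (c u₀ v₀))
    (ι : Type) [Fintype ι] [DecidableEq ι] (c : ι → ι → ℝ) (hc : ∀ a b, 0 ≤ c a b) (j : Fin (2 * k) → ι)
    (u₀ v₀ : ι) (hj : Function.Injective j) (hu₀ : u₀ ∉ Set.range j) (hv₀ : v₀ ∉ Set.range j) (huv : u₀ ≠ v₀) :
    0 ≤ (-1 : ℝ) ^ (k - 1) * deriv (fun t : ℝ => PairIsing.ursell (setCoupling c u₀ v₀ t) j) (c u₀ v₀) := by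
  have hK := edgeK_nonneg hc
  have hn : 0 < 2 * k := by omega
  set X : Finset ι := (univ : Finset (Fin (2 * k))).map ⟨j, hj⟩ with hXdef
  have haX : u₀ ∉ X := fun h => by
    obtain ⟨i, -, hi⟩ := Finset.mem_map.1 h
    exact hu₀ ⟨i, hi⟩
  have hbX : v₀ ∉ X := fun h => by
    obtain ⟨i, -, hi⟩ := Finset.mem_map.1 h
    exact hv₀ ⟨i, hi⟩
  have hX : #X = 2 * k := by rw [hXdef, card_map, card_univ, Fintype.card_fin]
  rw [deriv_ursell_setCoupling_eq_Dab hc huv hn hj hu₀ hv₀]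
  have hC := Current.masterC hK huv haX hbX hX
  have hterms : 0 ≤ (-1 : ℝ) ^ (k - 1) *
      ∑ x ∈ X, ∑ A : Finset ι, (Current.cw (edgeK c) u₀ A {u₀, x} * Current.nu2 (edgeK c) A v₀ (X.erase x) +
        Current.cw (edgeK c) v₀ A {v₀, x} * Current.nu2 (edgeK c) A u₀ (X.erase x)) := by
    rw [mul_sum]
    refine sum_nonneg fun x hx => ?_
    rw [mul_sum]
    refine sum_nonneg fun A _ => ?_
    have hcard : #(X.erase x) = 2 * k - 1 := by rw [card_erase_of_mem hx, hX]
    have h1 := nu2_sign hk HS IHT hc A (fun h => hbX (mem_of_mem_erase h)) hcard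
    have h2 := nu2_sign hk HS IHT hc A (fun h => haX (mem_of_mem_erase h)) hcard
    have hcw1 : 0 ≤ Current.cw (edgeK c) u₀ A {u₀, x} := by
      unfold Current.cw; split_ifs; exacts [Current.rhoI_nonneg hK u₀ A _, le_rfl]
    have hcw2 : 0 ≤ Current.cw (edgeK c) v₀ A {v₀, x} := by
      unfold Current.cw; split_ifs; exacts [Current.rhoI_nonneg hK v₀ A _, le_rfl]
    calc (0 : ℝ) ≤ Current.cw (edgeK c) u₀ A {u₀, x} * ((-1 : ℝ) ^ (k - 1) * Current.nu2 (edgeK c) A v₀ (X.erase x)) +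
          Current.cw (edgeK c) v₀ A {v₀, x} * ((-1 : ℝ) ^ (k - 1) * Current.nu2 (edgeK c) A u₀ (X.erase x)) :=
          add_nonneg (mul_nonneg hcw1 h1) (mul_nonneg hcw2 h2)
      _ = _ := by ring
  rw [← hC, ← mul_assoc, mul_comm ((-1 : ℝ) ^ (k - 1)), mul_assoc] at hterms
  have hpos : (0 : ℝ) < (2 * k : ℝ) := by exact_mod_cast hn
  exact nonneg_of_mul_nonneg_right hterms hpos

/-- **The joint induction**: Shlosman's signs and the Camia–Jiang–Newman derivative signs at every order.
[cite: CamiaJiangNewman2023, Theorem 1] -/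
theorem sign_and_deriv (k : ℕ) (hk : 1 ≤ k) :
    (∀ (ι : Type) [Fintype ι] [DecidableEq ι] (c : ι → ι → ℝ), (∀ a b, 0 ≤ c a b) →
        ∀ W : Finset ι, #W = 2 * k → 0 ≤ (-1 : ℝ) ^ (k - 1) * Current.uK (edgeK c) W) ∧
      (∀ (ι : Type) [Fintype ι] [DecidableEq ι] (c : ι → ι → ℝ), (∀ a b, 0 ≤ c a b) →
        ∀ (j : Fin (2 * k) → ι) (u₀ v₀ : ι), u₀ ≠ v₀ →
          0 ≤ (-1 : ℝ) ^ (k - 1) * deriv (fun t : ℝ => PairIsing.ursell (setCoupling c u₀ v₀ t) j) (c u₀ v₀)) := by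
  induction k using Nat.strong_induction_on with
  | _ k IH =>
    have IHS : ∀ m, 1 ≤ m → m < k → ∀ (ι : Type) [Fintype ι] [DecidableEq ι] (c : ι → ι → ℝ), (∀ a b, 0 ≤ c a b) →
        ∀ W : Finset ι, #W = 2 * m → 0 ≤ (-1 : ℝ) ^ (m - 1) * Current.uK (edgeK c) W :=
      fun m hm hmk => (IH m hmk hm).1
    have IHT : ∀ m, 1 ≤ m → m < k → ∀ (ι : Type) [Fintype ι] [DecidableEq ι] (c : ι → ι → ℝ), (∀ a b, 0 ≤ c a b) →
        ∀ (j : Fin (2 * m) → ι) (u₀ v₀ : ι), u₀ ≠ v₀ →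
          0 ≤ (-1 : ℝ) ^ (m - 1) * deriv (fun t : ℝ => PairIsing.ursell (setCoupling c u₀ v₀ t) j) (c u₀ v₀) :=
      fun m hm hmk => (IH m hmk hm).2
    have HSk := sign_step hk IHS IHT
    have HS : ∀ m, 1 ≤ m → m ≤ k → ∀ (ι : Type) [Fintype ι] [DecidableEq ι] (c : ι → ι → ℝ), (∀ a b, 0 ≤ c a b) →
        ∀ W : Finset ι, #W = 2 * m → 0 ≤ (-1 : ℝ) ^ (m - 1) * Current.uK (edgeK c) W := by
      intro m hm hmk
      rcases hmk.lt_or_eq with hlt | rfl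
      · exact IHS m hm hlt
      · exact HSk
    exact ⟨HSk, levelT_of_clean (deriv_step_clean hk HS IHT)⟩

end Induction

/-! ### The named fact and Shlosman's sign theorem -/

/-- **Camia–Jiang–Newman 2023, Theorem 1** (all orders): for a finite ferromagnetic pair interaction `c ≥ 0`, any
`2k` sites and `u₀ ≠ v₀`, `(-1)^{k-1} ∂u_{2k}/∂J_{u₀v₀} ≥ 0`. [cite: CamiaJiangNewman2023, Theorem 1] -/
theorem CamiaJiangNewman2023_thm1_holds : CamiaJiangNewman2023_thm1 :=
  fun ι _ _ c hc k hk j u₀ v₀ huv => (sign_and_deriv k hk).2 ι c hc j u₀ v₀ huv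

/-- **Shlosman's sign theorem** (all orders): `(-1)^{k-1} u_{2k}(σ_{j_1},…,σ_{j_{2k}}) ≥ 0` for distinct sites of a
finite ferromagnetic pair interaction. [cite: Shlosman1986, Theorem 1] -/
theorem PairIsing.ursell_sign {ι : Type} [Fintype ι] [DecidableEq ι] {c : ι → ι → ℝ} (hc : ∀ a b, 0 ≤ c a b)
    {k : ℕ} (hk : 1 ≤ k) {j : Fin (2 * k) → ι} (hj : Function.Injective j) :
    0 ≤ (-1 : ℝ) ^ (k - 1) * PairIsing.ursell c j := by
  rw [← uK_edgeK_map hc (by omega) hj]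
  exact (sign_and_deriv k hk).1 ι c hc _ (by rw [card_map, card_univ, Fintype.card_fin])



end Literature.Probability.LatticeModels

end
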